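/-
Copyright (c) 2026. All rights reserved.
Released under Apache 2.0 license as described in the file LICENSE.
-/
import Literature.NumberTheory.Automorphic.MaximalOrderDiscThirteenLattice
import Literature.NumberTheory.GeometryOfNumbers.MinkowskiPrimeDenominator
import HarnessLib

/-!
# The Dedekind–Hasse criterion for the maximal order `O₁₃` of `(−2,−13 ∣ ℚ)`: for every `ρ ∈ B ∖ O₁₃` there are
# `α, β ∈ O₁₃` with `0 < nrd(ρα − β) < 1` — by Minkowski's convex body theorem at the primes `p ≥ 11` and kernel-checked
# certificates at `p ∈ {2, 3, 5, 7}`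

[tag: quaternion_algebra] [tag: maximal_order] [tag: class_number] [tag: geometry_of_numbers]

Topic `NumberTheory/Automorphic`; THEOREMS ONLY (no definition, no named fact, no instance; net Literature debt `0`).
Lane `lit-hodgefound`, seat p12, gen 46 — third file of the series on the definite quaternion order of discriminant `13`
(`MaximalOrderDiscThirteenLattice`: `O₁₃ = ℤ⟨1, i, α, η⟩ ⊂ ℍ[ℚ,−2,−13]`, `α = (1+i+j)/2`, `η = (−2+i+k)/4`,
`nrd(a + bi + cα + dη) = Q₁₃(a,b,c,d) := a² + 2b² + 4c² + 2d² + ac − ad + 2bc + bd`), the `D = 13` counterpart of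
`MaximalOrderDiscSevenDedekindHasse`.

The maximal orders of discriminant `7` and `13` have class number one but are NOT norm-Euclidean (Voight Exercise 17.10 (c),
Thm. 25.4.1). Cardoso–Machiavelo prove `# Cls = 1` for them by the DEDEKIND–HASSE CRITERION (their Thm. 3): an order `H` in a
definite rational quaternion algebra `A` is a right PID iff `∀ ρ ∈ A ∖ H ∃ α, β ∈ H : 0 < N(ρα − β) < 1`, reduced (Prop. 2,
Cor. 1, Thm. 4, Prop. 3, Thm. 7) to `ρ = δ/p` (`p` prime, `δ` mod `pH`); for the discriminant-`13` order the source checks the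
primes `p ≤ 113` by computer (§5.2, Thm. 9, «1 339 411 quaternions over the first 30 primes»). This file PROVES THE CRITERION'S
HYPOTHESIS FOR `O₁₃` with a much smaller finite part, replacing the box principle by MINKOWSKI'S CONVEX BODY THEOREM: the
lattice `ℤ⁴ + ℤ·X/p ∋` (coordinates of) `β + (m/p)δ` has determinant `1/p`, and the ellipsoid `Q₁₃ < 1` has volume
`π²/2 · 4/13`, so Hardy–Wright's Thm. 451 (the tree's `MinkowskiPrimeDenominator`: `32·(13/4) = 104 < π²p`) produces a scalar
multiplier `α = m` with `0 < nrd((δ/p)m − β) < 1` as soon as `p ≥ 11`; the primes `2, 3, 5, 7` are settled by `decide`: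

* §1 coordinates: `mk_mul_negOne`, `mk_mul_etaSubOne`, `mk_mul_w3`, `mk_mul_w4`, `mk_mul_w5` (right multiplication by the five
  multipliers `−1, η − 1, −2 − i + 2η, −1 + i − η, −i + η`), `mk_mul_intCast`, `centred_modEq`, `mk_add_smul_mk`; **`exists_beta`**
  (THE REDUCTION STEP: if `c ∈ ℤ⁴` is congruent mod `p` to the coordinates of `δα` and `0 < Q₁₃(c) < p²`, then `β := (δα − c)/p ∈ O₁₃`
  has `nrd((δ/p)α − β) = Q₁₃(c)/p² ∈ (0,1)`), `exists_of_add_smul`;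
* §2 **the certificates** `cert_p`, `p = 2, 3, 5, 7` (private; `decide +kernel` over all `p⁴ − 1` residue classes `δ mod pO₁₃`,
  each settled by one of the five multipliers with the centred lift), `cert_sound`, **`exists_alpha_beta_of_prime_le`** (`p ≤ 7`);
* §3 large primes by MINKOWSKI: `sum_sq_sqrtMatrix_mulVec` (`Q₁₃(w) = Σᵢ (Bw)ᵢ²` for the upper-triangular real square root `B`),
  `det_sqrtMatrix` (`det B = 13/4`), **`exists_alpha_beta_of_eleven_le`** (primes `p ≥ 11`, scalar multiplier `α = m`);
* §4 **`exists_alpha_beta_of_prime`** (all primes — none lies in `{8, 9, 10}`), and the criterion **`dedekindHasse`**: FOR EVERY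
  `ρ ∈ ℍ[ℚ,−2,−13] ∖ O₁₃` THERE ARE `α, β ∈ O₁₃` WITH `0 < nrd(ρα − β) < 1`.

## Sources

* A. Cardoso, A. Machiavelo, *The Dedekind–Hasse Criterion in Quaternion Algebras*, arXiv:2506.22651 (2025): Thm. 3 (the
  criterion), Prop. 2, Cor. 1, Thm. 4 (reduction to `δ/p`), Thm. 6, Prop. 3, Thm. 7, §5.2 and Thm. 9 («`H₇,₁₃` is a PID»: the
  maximal order of discriminant `13`, there presented inside `(−7,−13 ∣ ℚ)`). [cite: CardosoMachiavelo2025, Thm. 3, Thm. 4, Thm. 6, Thm. 7, §5.2 Thm. 9]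
* G. H. Hardy, E. M. Wright, *An Introduction to the Theory of Numbers*, 6th ed. (2008), §24.2 Thm. 451 (Minkowski on
  `ξ₁² + ⋯ + ξₙ²`). [cite: HardyWright2008, §24.2 Thm. 451]
* J. W. S. Cassels, *An Introduction to the Geometry of Numbers* (1997), Ch. III §7.2–7.3 (sums of two and four squares by
  Minkowski's theorem with congruence lattices). [cite: Cassels1997, Ch. III §7.2–7.3]
* J. Voight, *Quaternion Algebras*, GTM 288 (2021), Thm. 25.4.1 (`D = 13`), Exercise 17.10 (c) (not norm-Euclidean).
  [cite: Voight2021, Thm. 25.4.1 (D = 13); Exercise 17.10 (c)]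

## Scope (honest)

Theorems only — no definition, no named fact, no instance. The multipliers used here (five fixed elements for `p ≤ 7`, an
integer `m` from Minkowski's theorem for `p ≥ 11`) are this file's own certificate, not the pairs found by the source's PARI/GP
run inside `(−7,−13 ∣ ℚ)`; the equivalence "PID ⟺ criterion" (the direction ⟹ of Thm. 3) is not formalised.
-/

open Quaternion
open scoped Pointwise
open Literature.NumberTheory.Automorphic.Brandt
open Literature.NumberTheory.GeometryOfNumbers

namespace Literature.NumberTheory.Automorphic.MaxOrderDiscThirteen

/-! ## §1 Coordinates and the reduction step -/

section Coordinates

/-- Right multiplication by `−1` in the coordinates of `O₁₃`: `(A + Bi + Cα + Dη)·(−1)` has coordinates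
`(-A, -B, -C, -D)`. [folklore] -/
private theorem mk_mul_negOne (A B C D : ℤ) :
    (⟨((A : ℚ) : ℚ) + ((C : ℚ) : ℚ) / 2 - ((D : ℚ) : ℚ) / 2, ((B : ℚ) : ℚ) + ((C : ℚ) : ℚ) / 2 + ((D : ℚ) : ℚ) / 4, ((C : ℚ) : ℚ) / 2, ((D : ℚ) : ℚ) / 4⟩ : ℍ[ℚ,-2,-13]) *
        (⟨((-1 : ℤ) : ℚ) + ((0 : ℤ) : ℚ) / 2 - ((0 : ℤ) : ℚ) / 2, ((0 : ℤ) : ℚ) + ((0 : ℤ) : ℚ) / 2 + ((0 : ℤ) : ℚ) / 4, ((0 : ℤ) : ℚ) / 2, ((0 : ℤ) : ℚ) / 4⟩ : ℍ[ℚ,-2,-13]) =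
      (⟨(((-A) : ℤ) : ℚ) + (((-C) : ℤ) : ℚ) / 2 - (((-D) : ℤ) : ℚ) / 2, (((-B) : ℤ) : ℚ) + (((-C) : ℤ) : ℚ) / 2 + (((-D) : ℤ) : ℚ) / 4, (((-C) : ℤ) : ℚ) / 2, (((-D) : ℤ) : ℚ) / 4⟩ : ℍ[ℚ,-2,-13]) := by
  ext <;> simp [QuaternionAlgebra.mk_mul_mk] <;> ring

/-- Right multiplication by `η − 1` in the coordinates of `O₁₃`: `(A + Bi + Cα + Dη)·(η − 1)` has coordinates
`(-A - 2 * D, -B + 2 * C, -B - 2 * C, A - 2 * D)`. [folklore] -/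
private theorem mk_mul_etaSubOne (A B C D : ℤ) :
    (⟨((A : ℚ) : ℚ) + ((C : ℚ) : ℚ) / 2 - ((D : ℚ) : ℚ) / 2, ((B : ℚ) : ℚ) + ((C : ℚ) : ℚ) / 2 + ((D : ℚ) : ℚ) / 4, ((C : ℚ) : ℚ) / 2, ((D : ℚ) : ℚ) / 4⟩ : ℍ[ℚ,-2,-13]) *
        (⟨((-1 : ℤ) : ℚ) + ((0 : ℤ) : ℚ) / 2 - ((1 : ℤ) : ℚ) / 2, ((0 : ℤ) : ℚ) + ((0 : ℤ) : ℚ) / 2 + ((1 : ℤ) : ℚ) / 4, ((0 : ℤ) : ℚ) / 2, ((1 : ℤ) : ℚ) / 4⟩ : ℍ[ℚ,-2,-13]) =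
      (⟨(((-A - 2 * D) : ℤ) : ℚ) + (((-B - 2 * C) : ℤ) : ℚ) / 2 - (((A - 2 * D) : ℤ) : ℚ) / 2, (((-B + 2 * C) : ℤ) : ℚ) + (((-B - 2 * C) : ℤ) : ℚ) / 2 + (((A - 2 * D) : ℤ) : ℚ) / 4, (((-B - 2 * C) : ℤ) : ℚ) / 2, (((A - 2 * D) : ℤ) : ℚ) / 4⟩ : ℍ[ℚ,-2,-13]) := by
  ext <;> simp [QuaternionAlgebra.mk_mul_mk] <;> ring

/-- Right multiplication by `−2 − i + 2η` in the coordinates of `O₁₃`: `(A + Bi + Cα + Dη)·(−2 − i + 2η)` has coordinates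
`(-2 * A + 2 * B + 2 * C - 3 * D, -A - 2 * B + 3 * C + D, -2 * B - 4 * C - D, 2 * A + 2 * C - 4 * D)`. [folklore] -/
private theorem mk_mul_w3 (A B C D : ℤ) :
    (⟨((A : ℚ) : ℚ) + ((C : ℚ) : ℚ) / 2 - ((D : ℚ) : ℚ) / 2, ((B : ℚ) : ℚ) + ((C : ℚ) : ℚ) / 2 + ((D : ℚ) : ℚ) / 4, ((C : ℚ) : ℚ) / 2, ((D : ℚ) : ℚ) / 4⟩ : ℍ[ℚ,-2,-13]) *
        (⟨((-2 : ℤ) : ℚ) + ((0 : ℤ) : ℚ) / 2 - ((2 : ℤ) : ℚ) / 2, ((-1 : ℤ) : ℚ) + ((0 : ℤ) : ℚ) / 2 + ((2 : ℤ) : ℚ) / 4, ((0 : ℤ) : ℚ) / 2, ((2 : ℤ) : ℚ) / 4⟩ : ℍ[ℚ,-2,-13]) =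
      (⟨(((-2 * A + 2 * B + 2 * C - 3 * D) : ℤ) : ℚ) + (((-2 * B - 4 * C - D) : ℤ) : ℚ) / 2 - (((2 * A + 2 * C - 4 * D) : ℤ) : ℚ) / 2, (((-A - 2 * B + 3 * C + D) : ℤ) : ℚ) + (((-2 * B - 4 * C - D) : ℤ) : ℚ) / 2 + (((2 * A + 2 * C - 4 * D) : ℤ) : ℚ) / 4, (((-2 * B - 4 * C - D) : ℤ) : ℚ) / 2, (((2 * A + 2 * C - 4 * D) : ℤ) : ℚ) / 4⟩ : ℍ[ℚ,-2,-13]) := by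
  ext <;> simp [QuaternionAlgebra.mk_mul_mk] <;> ring

/-- Right multiplication by `−1 + i − η` in the coordinates of `O₁₃`: `(A + Bi + Cα + Dη)·(−1 + i − η)` has coordinates
`(-A - 2 * B - 2 * C + D, A - B - C - D, B + D, -A - 2 * C)`. [folklore] -/
private theorem mk_mul_w4 (A B C D : ℤ) :
    (⟨((A : ℚ) : ℚ) + ((C : ℚ) : ℚ) / 2 - ((D : ℚ) : ℚ) / 2, ((B : ℚ) : ℚ) + ((C : ℚ) : ℚ) / 2 + ((D : ℚ) : ℚ) / 4, ((C : ℚ) : ℚ) / 2, ((D : ℚ) : ℚ) / 4⟩ : ℍ[ℚ,-2,-13]) *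
        (⟨((-1 : ℤ) : ℚ) + ((0 : ℤ) : ℚ) / 2 - ((-1 : ℤ) : ℚ) / 2, ((1 : ℤ) : ℚ) + ((0 : ℤ) : ℚ) / 2 + ((-1 : ℤ) : ℚ) / 4, ((0 : ℤ) : ℚ) / 2, ((-1 : ℤ) : ℚ) / 4⟩ : ℍ[ℚ,-2,-13]) =
      (⟨(((-A - 2 * B - 2 * C + D) : ℤ) : ℚ) + (((B + D) : ℤ) : ℚ) / 2 - (((-A - 2 * C) : ℤ) : ℚ) / 2, (((A - B - C - D) : ℤ) : ℚ) + (((B + D) : ℤ) : ℚ) / 2 + (((-A - 2 * C) : ℤ) : ℚ) / 4, (((B + D) : ℤ) : ℚ) / 2, (((-A - 2 * C) : ℤ) : ℚ) / 4⟩ : ℍ[ℚ,-2,-13]) := by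
  ext <;> simp [QuaternionAlgebra.mk_mul_mk] <;> ring

/-- Right multiplication by `−i + η` in the coordinates of `O₁₃`: `(A + Bi + Cα + Dη)·(−i + η)` has coordinates
`(2 * B + 2 * C - D, -A + C + D, -B - C - D, A + 2 * C - D)`. [folklore] -/
private theorem mk_mul_w5 (A B C D : ℤ) :
    (⟨((A : ℚ) : ℚ) + ((C : ℚ) : ℚ) / 2 - ((D : ℚ) : ℚ) / 2, ((B : ℚ) : ℚ) + ((C : ℚ) : ℚ) / 2 + ((D : ℚ) : ℚ) / 4, ((C : ℚ) : ℚ) / 2, ((D : ℚ) : ℚ) / 4⟩ : ℍ[ℚ,-2,-13]) *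
        (⟨((0 : ℤ) : ℚ) + ((0 : ℤ) : ℚ) / 2 - ((1 : ℤ) : ℚ) / 2, ((-1 : ℤ) : ℚ) + ((0 : ℤ) : ℚ) / 2 + ((1 : ℤ) : ℚ) / 4, ((0 : ℤ) : ℚ) / 2, ((1 : ℤ) : ℚ) / 4⟩ : ℍ[ℚ,-2,-13]) =
      (⟨(((2 * B + 2 * C - D) : ℤ) : ℚ) + (((-B - C - D) : ℤ) : ℚ) / 2 - (((A + 2 * C - D) : ℤ) : ℚ) / 2, (((-A + C + D) : ℤ) : ℚ) + (((-B - C - D) : ℤ) : ℚ) / 2 + (((A + 2 * C - D) : ℤ) : ℚ) / 4, (((-B - C - D) : ℤ) : ℚ) / 2, (((A + 2 * C - D) : ℤ) : ℚ) / 4⟩ : ℍ[ℚ,-2,-13]) := by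
  ext <;> simp [QuaternionAlgebra.mk_mul_mk] <;> ring

/-- Right multiplication by an integer `u` scales the coordinates. [folklore] -/
private theorem mk_mul_intCast (A B C D u : ℤ) :
    (⟨(A : ℚ) + (C : ℚ) / 2 - (D : ℚ) / 2, (B : ℚ) + (C : ℚ) / 2 + (D : ℚ) / 4, (C : ℚ) / 2, (D : ℚ) / 4⟩ : ℍ[ℚ,-2,-13]) *
        (⟨((u : ℤ) : ℚ) + ((0 : ℤ) : ℚ) / 2 - ((0 : ℤ) : ℚ) / 2, ((0 : ℤ) : ℚ) + ((0 : ℤ) : ℚ) / 2 + ((0 : ℤ) : ℚ) / 4,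
          ((0 : ℤ) : ℚ) / 2, ((0 : ℤ) : ℚ) / 4⟩ : ℍ[ℚ,-2,-13]) =
      ⟨((u * A : ℤ) : ℚ) + ((u * C : ℤ) : ℚ) / 2 - ((u * D : ℤ) : ℚ) / 2, ((u * B : ℤ) : ℚ) + ((u * C : ℤ) : ℚ) / 2 +
        ((u * D : ℤ) : ℚ) / 4, ((u * C : ℤ) : ℚ) / 2, ((u * D : ℤ) : ℚ) / 4⟩ := by
  ext <;> simp [QuaternionAlgebra.mk_mul_mk] <;> ring

/-- The centred residue `((L + h) mod n) − h` is congruent to `L` mod `n`. [folklore] -/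
private theorem centred_modEq (L h n : ℤ) : ((L + h) % n - h) ≡ L [ZMOD n] := by
  have h1 : (L + h) % n ≡ L + h [ZMOD n] := Int.mod_modEq _ _
  have h2 := h1.sub_right h
  rwa [add_sub_cancel_right] at h2

/-- `O₁₃`-coordinates are additive: `mk(a) + n • mk(t) = mk(a + n t)`. [folklore] -/
private theorem mk_add_smul_mk (a₀ a₁ a₂ a₃ t₀ t₁ t₂ t₃ n : ℤ) :
    (⟨(a₀ : ℚ) + (a₂ : ℚ) / 2 - (a₃ : ℚ) / 2, (a₁ : ℚ) + (a₂ : ℚ) / 2 + (a₃ : ℚ) / 4, (a₂ : ℚ) / 2, (a₃ : ℚ) / 4⟩ : ℍ[ℚ,-2,-13]) +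
        (n : ℚ) • (⟨(t₀ : ℚ) + (t₂ : ℚ) / 2 - (t₃ : ℚ) / 2, (t₁ : ℚ) + (t₂ : ℚ) / 2 + (t₃ : ℚ) / 4, (t₂ : ℚ) / 2,
          (t₃ : ℚ) / 4⟩ : ℍ[ℚ,-2,-13]) =
      ⟨((a₀ + n * t₀ : ℤ) : ℚ) + ((a₂ + n * t₂ : ℤ) : ℚ) / 2 - ((a₃ + n * t₃ : ℤ) : ℚ) / 2,
        ((a₁ + n * t₁ : ℤ) : ℚ) + ((a₂ + n * t₂ : ℤ) : ℚ) / 2 + ((a₃ + n * t₃ : ℤ) : ℚ) / 4, ((a₂ + n * t₂ : ℤ) : ℚ) / 2,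
        ((a₃ + n * t₃ : ℤ) : ℚ) / 4⟩ := by
  ext <;> simp <;> ring

/-- **THE REDUCTION STEP.** Let `x, γ ∈ O₁₃` with `xγ = P₀ + P₁i + P₂α + P₃η`, `p ≥ 1`, and `c ∈ ℤ⁴` with `cᵢ ≡ Pᵢ (mod p)` and
`0 < Q₁₃(c) < p²`. Then `β := (xγ − c)/p ∈ O₁₃` satisfies `0 < nrd((x/p)γ − β) = Q₁₃(c)/p² < 1`.
[cite: CardosoMachiavelo2025, Prop. 3 and Thm. 7 (β by rounding the coordinates of αρ)] -/
theorem exists_beta {p : ℕ} (hp : 0 < p) {x γ : ℍ[ℚ,-2,-13]} (hγ : γ ∈ (Submodule.span ℤ (Set.range ![(⟨1, 0, 0, 0⟩ : ℍ[ℚ,-2,-13]), ⟨0, 1, 0, 0⟩, ⟨1/2, 1/2, 1/2, 0⟩, ⟨-1/2, 1/4, 0, 1/4⟩]))) {P₀ P₁ P₂ P₃ c₀ c₁ c₂ c₃ : ℤ}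
    (hx : x * γ = ⟨(P₀ : ℚ) + (P₂ : ℚ) / 2 - (P₃ : ℚ) / 2, (P₁ : ℚ) + (P₂ : ℚ) / 2 + (P₃ : ℚ) / 4, (P₂ : ℚ) / 2, (P₃ : ℚ) / 4⟩)
    (h₀ : c₀ ≡ P₀ [ZMOD (p : ℤ)]) (h₁ : c₁ ≡ P₁ [ZMOD (p : ℤ)]) (h₂ : c₂ ≡ P₂ [ZMOD (p : ℤ)]) (h₃ : c₃ ≡ P₃ [ZMOD (p : ℤ)])
    (hpos : 0 < c₀ ^ 2 + 2 * c₁ ^ 2 + 4 * c₂ ^ 2 + 2 * c₃ ^ 2 + c₀ * c₂ - c₀ * c₃ + 2 * c₁ * c₂ + c₁ * c₃)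
    (hlt : c₀ ^ 2 + 2 * c₁ ^ 2 + 4 * c₂ ^ 2 + 2 * c₃ ^ 2 + c₀ * c₂ - c₀ * c₃ + 2 * c₁ * c₂ + c₁ * c₃ < (p : ℤ) ^ 2) :
    ∃ β ∈ (Submodule.span ℤ (Set.range ![(⟨1, 0, 0, 0⟩ : ℍ[ℚ,-2,-13]), ⟨0, 1, 0, 0⟩, ⟨1/2, 1/2, 1/2, 0⟩, ⟨-1/2, 1/4, 0, 1/4⟩])), 0 < reducedNorm ℚ ℍ[ℚ,-2,-13] (((p : ℚ)⁻¹ • x) * γ - β) ∧ reducedNorm ℚ ℍ[ℚ,-2,-13] (((p : ℚ)⁻¹ • x) * γ - β) < 1 := by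
  haveI := isQuaternionAlgebra
  have _ := hγ
  obtain ⟨e₀, he₀⟩ := Int.ModEq.dvd h₀
  obtain ⟨e₁, he₁⟩ := Int.ModEq.dvd h₁
  obtain ⟨e₂, he₂⟩ := Int.ModEq.dvd h₂
  obtain ⟨e₃, he₃⟩ := Int.ModEq.dvd h₃
  have hp' : (p : ℚ) ≠ 0 := by exact_mod_cast hp.ne'
  have hP₀ : (P₀ : ℚ) = c₀ + (p : ℚ) * e₀ := by
    have h := congrArg (fun z : ℤ => (z : ℚ)) he₀; push_cast at h; linarith
  have hP₁ : (P₁ : ℚ) = c₁ + (p : ℚ) * e₁ := by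
    have h := congrArg (fun z : ℤ => (z : ℚ)) he₁; push_cast at h; linarith
  have hP₂ : (P₂ : ℚ) = c₂ + (p : ℚ) * e₂ := by
    have h := congrArg (fun z : ℤ => (z : ℚ)) he₂; push_cast at h; linarith
  have hP₃ : (P₃ : ℚ) = c₃ + (p : ℚ) * e₃ := by
    have h := congrArg (fun z : ℤ => (z : ℚ)) he₃; push_cast at h; linarith
  refine ⟨⟨(e₀ : ℚ) + (e₂ : ℚ) / 2 - (e₃ : ℚ) / 2, (e₁ : ℚ) + (e₂ : ℚ) / 2 + (e₃ : ℚ) / 4, (e₂ : ℚ) / 2, (e₃ : ℚ) / 4⟩,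
    mk_mem_lattice e₀ e₁ e₂ e₃, ?_⟩
  have key : ((p : ℚ)⁻¹ • x) * γ -
      ⟨(e₀ : ℚ) + (e₂ : ℚ) / 2 - (e₃ : ℚ) / 2, (e₁ : ℚ) + (e₂ : ℚ) / 2 + (e₃ : ℚ) / 4, (e₂ : ℚ) / 2, (e₃ : ℚ) / 4⟩ =
      (p : ℚ)⁻¹ • (⟨(c₀ : ℚ) + (c₂ : ℚ) / 2 - (c₃ : ℚ) / 2, (c₁ : ℚ) + (c₂ : ℚ) / 2 + (c₃ : ℚ) / 4, (c₂ : ℚ) / 2,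
        (c₃ : ℚ) / 4⟩ : ℍ[ℚ,-2,-13]) := by
    rw [smul_mul_assoc, hx]
    ext <;> simp [hP₀, hP₁, hP₂, hP₃] <;> field_simp <;> ring
  rw [key, reducedNorm_smul, reducedNorm_mk]
  have hq : (0 : ℚ) < (p : ℚ)⁻¹ ^ 2 := by positivity
  have hp2 : ((p : ℚ)⁻¹) ^ 2 * ((p : ℤ) ^ 2 : ℤ) = 1 := by push_cast; field_simp
  constructor
  · have h : (0 : ℚ) < ((c₀ ^ 2 + 2 * c₁ ^ 2 + 4 * c₂ ^ 2 + 2 * c₃ ^ 2 + c₀ * c₂ - c₀ * c₃ + 2 * c₁ * c₂ + c₁ * c₃ : ℤ) : ℚ) := by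
      exact_mod_cast hpos
    positivity
  · have h : ((c₀ ^ 2 + 2 * c₁ ^ 2 + 4 * c₂ ^ 2 + 2 * c₃ ^ 2 + c₀ * c₂ - c₀ * c₃ + 2 * c₁ * c₂ + c₁ * c₃ : ℤ) : ℚ) <
        (((p : ℤ) ^ 2 : ℤ) : ℚ) := by
      exact_mod_cast hlt
    calc (p : ℚ)⁻¹ ^ 2 * ((c₀ ^ 2 + 2 * c₁ ^ 2 + 4 * c₂ ^ 2 + 2 * c₃ ^ 2 + c₀ * c₂ - c₀ * c₃ + 2 * c₁ * c₂ + c₁ * c₃ : ℤ) : ℚ)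
        < (p : ℚ)⁻¹ ^ 2 * (((p : ℤ) ^ 2 : ℤ) : ℚ) := mul_lt_mul_of_pos_left h hq
      _ = 1 := hp2

/-- Translation by `pO₁₃` does not change the problem: if `x = x' + p·y` with `y ∈ O₁₃`, multipliers for `x'/p` serve for `x/p`
(`β ↦ β + yγ`). [cite: CardosoMachiavelo2025, Prop. 2 and Cor. 1] -/
theorem exists_of_add_smul {p : ℕ} (hp : 0 < p) {x x' y : ℍ[ℚ,-2,-13]} (hy : y ∈ (Submodule.span ℤ (Set.range ![(⟨1, 0, 0, 0⟩ : ℍ[ℚ,-2,-13]), ⟨0, 1, 0, 0⟩, ⟨1/2, 1/2, 1/2, 0⟩, ⟨-1/2, 1/4, 0, 1/4⟩]))) (e : x = x' + (p : ℚ) • y)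
    (h : ∃ γ ∈ (Submodule.span ℤ (Set.range ![(⟨1, 0, 0, 0⟩ : ℍ[ℚ,-2,-13]), ⟨0, 1, 0, 0⟩, ⟨1/2, 1/2, 1/2, 0⟩, ⟨-1/2, 1/4, 0, 1/4⟩])), ∃ β ∈ (Submodule.span ℤ (Set.range ![(⟨1, 0, 0, 0⟩ : ℍ[ℚ,-2,-13]), ⟨0, 1, 0, 0⟩, ⟨1/2, 1/2, 1/2, 0⟩, ⟨-1/2, 1/4, 0, 1/4⟩])),
      0 < reducedNorm ℚ ℍ[ℚ,-2,-13] (((p : ℚ)⁻¹ • x') * γ - β) ∧ reducedNorm ℚ ℍ[ℚ,-2,-13] (((p : ℚ)⁻¹ • x') * γ - β) < 1) :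
    ∃ γ ∈ (Submodule.span ℤ (Set.range ![(⟨1, 0, 0, 0⟩ : ℍ[ℚ,-2,-13]), ⟨0, 1, 0, 0⟩, ⟨1/2, 1/2, 1/2, 0⟩, ⟨-1/2, 1/4, 0, 1/4⟩])), ∃ β ∈ (Submodule.span ℤ (Set.range ![(⟨1, 0, 0, 0⟩ : ℍ[ℚ,-2,-13]), ⟨0, 1, 0, 0⟩, ⟨1/2, 1/2, 1/2, 0⟩, ⟨-1/2, 1/4, 0, 1/4⟩])),
      0 < reducedNorm ℚ ℍ[ℚ,-2,-13] (((p : ℚ)⁻¹ • x) * γ - β) ∧ reducedNorm ℚ ℍ[ℚ,-2,-13] (((p : ℚ)⁻¹ • x) * γ - β) < 1 := by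
  obtain ⟨γ, hγ, β, hβ, h1, h2⟩ := h
  have hp' : (p : ℚ) ≠ 0 := by exact_mod_cast hp.ne'
  refine ⟨γ, hγ, β + y * γ, ((Submodule.span ℤ (Set.range ![(⟨1, 0, 0, 0⟩ : ℍ[ℚ,-2,-13]), ⟨0, 1, 0, 0⟩, ⟨1/2, 1/2, 1/2, 0⟩, ⟨-1/2, 1/4, 0, 1/4⟩]))).add_mem hβ (mul_mem_lattice hy hγ), ?_⟩
  have key : ((p : ℚ)⁻¹ • x) * γ - (β + y * γ) = ((p : ℚ)⁻¹ • x') * γ - β := by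
    rw [e, smul_add, smul_smul, inv_mul_cancel₀ hp', one_smul, add_mul]
    abel
  rw [key]
  exact ⟨h1, h2⟩

end Coordinates

/-! ## §2 The primes `p ≤ 7`: kernel-checked certificates -/

section Certificates

set_option synthInstance.maxHeartbeats 400000 in
set_option synthInstance.maxSize 4000 in
/-- **The Dedekind–Hasse certificate at `p = 2`**: for every residue `δ = d₀ + d₁i + d₂α + d₃η ∈ O₁₃ ∖ 2O₁₃` one of the five
multipliers `−1, η − 1, −2 − i + 2η, −1 + i − η, −i + η` gives a centred lift `c` of the coordinates of `δ·(multiplier)` mod `2`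
with `0 < Q₁₃(c) < 2²` (checked by the kernel). [cite: CardosoMachiavelo2025, Thm. 7 and §5.2 Thm. 9 (the finite check for the discriminant-13 order)] -/
private theorem cert_2 : ∀ d₀ < (2 : ℕ), ∀ d₁ < (2 : ℕ), ∀ d₂ < (2 : ℕ), ∀ d₃ < (2 : ℕ),
    (d₀ ≠ 0 ∨ d₁ ≠ 0 ∨ d₂ ≠ 0 ∨ d₃ ≠ 0) →
      (0 < (((-(d₀ : ℤ)) + (0 : ℤ)) % ((2 : ℕ) : ℤ) - (0 : ℤ)) ^ 2 + 2 * (((-(d₁ : ℤ)) + (0 : ℤ)) % ((2 : ℕ) : ℤ) - (0 : ℤ)) ^ 2 + 4 * (((-(d₂ : ℤ)) + (0 : ℤ)) % ((2 : ℕ) : ℤ) - (0 : ℤ)) ^ 2 + 2 * (((-(d₃ : ℤ)) + (0 : ℤ)) % ((2 : ℕ) : ℤ) - (0 : ℤ)) ^ 2 + (((-(d₀ : ℤ)) + (0 : ℤ)) % ((2 : ℕ) : ℤ) - (0 : ℤ)) * (((-(d₂ : ℤ)) + (0 : ℤ)) % ((2 : ℕ) : ℤ) - (0 : ℤ)) -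 (((-(d₀ : ℤ)) + (0 : ℤ)) % ((2 : ℕ) : ℤ) - (0 : ℤ)) * (((-(d₃ : ℤ)) + (0 : ℤ)) % ((2 : ℕ) : ℤ) - (0 : ℤ)) + 2 * (((-(d₁ : ℤ)) + (0 : ℤ)) % ((2 : ℕ) : ℤ) - (0 : ℤ)) * (((-(d₂ : ℤ)) + (0 : ℤ)) % ((2 : ℕ) : ℤ) - (0 : ℤ)) + (((-(d₁ : ℤ)) + (0 : ℤ)) % ((2 : ℕ) : ℤ) - (0 : ℤ)) * (((-(d₃ : ℤ)) + (0 : ℤ)) % ((2 : ℕ) : ℤ) - (0 : ℤ)) ∧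
        (((-(d₀ : ℤ)) + (0 : ℤ)) % ((2 : ℕ) : ℤ) - (0 : ℤ)) ^ 2 + 2 * (((-(d₁ : ℤ)) + (0 : ℤ)) % ((2 : ℕ) : ℤ) - (0 : ℤ)) ^ 2 + 4 * (((-(d₂ : ℤ)) + (0 : ℤ)) % ((2 : ℕ) : ℤ) - (0 : ℤ)) ^ 2 + 2 * (((-(d₃ : ℤ)) + (0 : ℤ)) % ((2 : ℕ) : ℤ) - (0 : ℤ)) ^ 2 + (((-(d₀ : ℤ)) + (0 : ℤ)) % ((2 : ℕ) : ℤ) - (0 : ℤ)) * (((-(d₂ : ℤ)) + (0 : ℤ)) % ((2 : ℕ) : ℤ) - (0 : ℤ)) - (((-(d₀ : ℤ)) + (0 : ℤ)) % ((2 : ℕ) : ℤ) - (0 : ℤ)) * (((-(d₃ : ℤ)) + (0 : ℤ)) % ((2 : ℕ) : ℤ) - (0 : ℤ)) + 2 * (((-(d₁ : ℤ)) + (0 : ℤ)) % ((2 : ℕ) : ℤ) - (0 : ℤ)) * (((-(d₂ : ℤ)) + (0 : ℤ)) % ((2 : ℕ) : ℤ) - (0 : ℤ)) + (((-(d₁ :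 ℤ)) + (0 : ℤ)) % ((2 : ℕ) : ℤ) - (0 : ℤ)) * (((-(d₃ : ℤ)) + (0 : ℤ)) % ((2 : ℕ) : ℤ) - (0 : ℤ)) < ((2 : ℕ) : ℤ) ^ 2) ∨
      (0 < (((-(d₀ : ℤ) - 2 * (d₃ : ℤ)) + (0 : ℤ)) % ((2 : ℕ) : ℤ) - (0 : ℤ)) ^ 2 + 2 * (((-(d₁ : ℤ) + 2 * (d₂ : ℤ)) + (0 : ℤ)) % ((2 : ℕ) : ℤ) - (0 : ℤ)) ^ 2 + 4 * (((-(d₁ : ℤ) - 2 * (d₂ : ℤ)) + (0 : ℤ)) % ((2 : ℕ) : ℤ) - (0 : ℤ)) ^ 2 + 2 * ((((d₀ : ℤ) - 2 * (d₃ : ℤ)) + (0 : ℤ)) % ((2 : ℕ) : ℤ) - (0 : ℤ)) ^ 2 + (((-(d₀ : ℤ) - 2 * (d₃ : ℤ)) + (0 : ℤ)) % ((2 : ℕ) : ℤ) - (0 : ℤ)) * (((-(d₁ : ℤ) - 2 * (d₂ : ℤ)) + (0 : ℤ)) % ((2 : ℕ) : ℤ) - (0 : ℤ)) - (((-(d₀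 : ℤ) - 2 * (d₃ : ℤ)) + (0 : ℤ)) % ((2 : ℕ) : ℤ) - (0 : ℤ)) * ((((d₀ : ℤ) - 2 * (d₃ : ℤ)) + (0 : ℤ)) % ((2 : ℕ) : ℤ) - (0 : ℤ)) + 2 * (((-(d₁ : ℤ) + 2 * (d₂ : ℤ)) + (0 : ℤ)) % ((2 : ℕ) : ℤ) - (0 : ℤ)) * (((-(d₁ : ℤ) - 2 * (d₂ : ℤ)) + (0 : ℤ)) % ((2 : ℕ) : ℤ) - (0 : ℤ)) + (((-(d₁ : ℤ) + 2 * (d₂ : ℤ)) + (0 : ℤ)) % ((2 : ℕ) : ℤ) - (0 : ℤ)) * ((((d₀ : ℤ) - 2 * (d₃ : ℤ)) + (0 : ℤ)) % ((2 : ℕ) : ℤ) - (0 : ℤ)) ∧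
        (((-(d₀ : ℤ) - 2 * (d₃ : ℤ)) + (0 : ℤ)) % ((2 : ℕ) : ℤ) - (0 : ℤ)) ^ 2 + 2 * (((-(d₁ : ℤ) + 2 * (d₂ : ℤ)) + (0 : ℤ)) % ((2 : ℕ) : ℤ) - (0 : ℤ)) ^ 2 + 4 * (((-(d₁ : ℤ) - 2 * (d₂ : ℤ)) + (0 : ℤ)) % ((2 : ℕ) : ℤ) - (0 : ℤ)) ^ 2 + 2 * ((((d₀ : ℤ) - 2 * (d₃ : ℤ)) + (0 : ℤ)) % ((2 : ℕ) : ℤ) - (0 : ℤ)) ^ 2 + (((-(d₀ : ℤ) - 2 * (d₃ : ℤ)) + (0 : ℤ)) % ((2 : ℕ) : ℤ) - (0 : ℤ)) * (((-(d₁ : ℤ) - 2 * (d₂ : ℤ)) + (0 : ℤ)) % ((2 : ℕ) : ℤ) - (0 : ℤ)) - (((-(d₀ : ℤ) - 2 * (d₃ : ℤ)) + (0 : ℤ)) % ((2 : ℕ) : ℤ) - (0 : ℤ)) * ((((d₀ : ℤ) - 2 * (d₃ : ℤ)) + (0 : ℤ)) % ((2 : ℕ) : ℤ) - (0 : ℤ))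 + 2 * (((-(d₁ : ℤ) + 2 * (d₂ : ℤ)) + (0 : ℤ)) % ((2 : ℕ) : ℤ) - (0 : ℤ)) * (((-(d₁ : ℤ) - 2 * (d₂ : ℤ)) + (0 : ℤ)) % ((2 : ℕ) : ℤ) - (0 : ℤ)) + (((-(d₁ : ℤ) + 2 * (d₂ : ℤ)) + (0 : ℤ)) % ((2 : ℕ) : ℤ) - (0 : ℤ)) * ((((d₀ : ℤ) - 2 * (d₃ : ℤ)) + (0 : ℤ)) % ((2 : ℕ) : ℤ) - (0 : ℤ)) < ((2 : ℕ) : ℤ) ^ 2) ∨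
      (0 < (((-2 * (d₀ : ℤ) + 2 * (d₁ : ℤ) + 2 * (d₂ : ℤ) - 3 * (d₃ : ℤ)) + (0 : ℤ)) % ((2 : ℕ) : ℤ) - (0 : ℤ)) ^ 2 + 2 * (((-(d₀ : ℤ) - 2 * (d₁ : ℤ) + 3 * (d₂ : ℤ) + (d₃ : ℤ)) + (0 : ℤ)) % ((2 : ℕ) : ℤ) - (0 : ℤ)) ^ 2 + 4 * (((-2 * (d₁ : ℤ) - 4 * (d₂ : ℤ) - (d₃ : ℤ)) + (0 : ℤ)) % ((2 : ℕ) : ℤ) - (0 : ℤ)) ^ 2 + 2 * (((2 * (d₀ : ℤ) + 2 * (d₂ : ℤ) - 4 * (d₃ : ℤ)) + (0 : ℤ)) % ((2 : ℕ) : ℤ) - (0 : ℤ)) ^ 2 + (((-2 * (d₀ : ℤ) + 2 * (d₁ : ℤ) + 2 * (d₂ : ℤ) - 3 * (d₃ : ℤ)) + (0 : ℤ)) % ((2 : ℕ) : ℤ) - (0 : ℤ)) * (((-2 * (d₁ : ℤ) - 4 * (d₂ : ℤ) - (d₃ : ℤ)) + (0 : ℤ)) % ((2 : ℕ) : ℤ)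 - (0 : ℤ)) - (((-2 * (d₀ : ℤ) + 2 * (d₁ : ℤ) + 2 * (d₂ : ℤ) - 3 * (d₃ : ℤ)) + (0 : ℤ)) % ((2 : ℕ) : ℤ) - (0 : ℤ)) * (((2 * (d₀ : ℤ) + 2 * (d₂ : ℤ) - 4 * (d₃ : ℤ)) + (0 : ℤ)) % ((2 : ℕ) : ℤ) - (0 : ℤ)) + 2 * (((-(d₀ : ℤ) - 2 * (d₁ : ℤ) + 3 * (d₂ : ℤ) + (d₃ : ℤ)) + (0 : ℤ)) % ((2 : ℕ) : ℤ) - (0 : ℤ)) * (((-2 * (d₁ : ℤ) - 4 * (d₂ : ℤ) - (d₃ : ℤ)) + (0 : ℤ)) % ((2 : ℕ) : ℤ) - (0 : ℤ)) + (((-(d₀ : ℤ) - 2 * (d₁ : ℤ) + 3 * (d₂ : ℤ) + (d₃ : ℤ)) + (0 : ℤ)) % ((2 : ℕ) : ℤ) - (0 : ℤ)) * (((2 * (d₀ : ℤ) + 2 * (d₂ : ℤ) - 4 * (d₃ : ℤ)) + (0 : ℤ)) % ((2 : ℕ) : ℤ) - (0 : ℤ)) ∧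
        (((-2 * (d₀ : ℤ) + 2 * (d₁ : ℤ) + 2 * (d₂ : ℤ) - 3 * (d₃ : ℤ)) + (0 : ℤ)) % ((2 : ℕ) : ℤ) - (0 : ℤ)) ^ 2 + 2 * (((-(d₀ : ℤ) - 2 * (d₁ : ℤ) + 3 * (d₂ : ℤ) + (d₃ : ℤ)) + (0 : ℤ)) % ((2 : ℕ) : ℤ) - (0 : ℤ)) ^ 2 + 4 * (((-2 * (d₁ : ℤ) - 4 * (d₂ : ℤ) - (d₃ : ℤ)) + (0 : ℤ)) % ((2 : ℕ) : ℤ) - (0 : ℤ)) ^ 2 + 2 * (((2 * (d₀ : ℤ) + 2 * (d₂ : ℤ) - 4 * (d₃ : ℤ)) + (0 : ℤ)) % ((2 : ℕ) : ℤ) - (0 : ℤ)) ^ 2 + (((-2 * (d₀ : ℤ) + 2 * (d₁ : ℤ) + 2 * (d₂ : ℤ) - 3 * (d₃ : ℤ)) + (0 : ℤ)) % ((2 : ℕ) : ℤ) - (0 : ℤ)) * (((-2 * (d₁ : ℤ) - 4 * (d₂ : ℤ) - (d₃ : ℤ)) + (0 : ℤ)) % ((2 : ℕ) : ℤ) - (0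 : ℤ)) - (((-2 * (d₀ : ℤ) + 2 * (d₁ : ℤ) + 2 * (d₂ : ℤ) - 3 * (d₃ : ℤ)) + (0 : ℤ)) % ((2 : ℕ) : ℤ) - (0 : ℤ)) * (((2 * (d₀ : ℤ) + 2 * (d₂ : ℤ) - 4 * (d₃ : ℤ)) + (0 : ℤ)) % ((2 : ℕ) : ℤ) - (0 : ℤ)) + 2 * (((-(d₀ : ℤ) - 2 * (d₁ : ℤ) + 3 * (d₂ : ℤ) + (d₃ : ℤ)) + (0 : ℤ)) % ((2 : ℕ) : ℤ) - (0 : ℤ)) * (((-2 * (d₁ : ℤ) - 4 * (d₂ : ℤ) - (d₃ : ℤ)) + (0 : ℤ)) % ((2 : ℕ) : ℤ) - (0 : ℤ)) + (((-(d₀ : ℤ) - 2 * (d₁ : ℤ) + 3 * (d₂ : ℤ) + (d₃ : ℤ)) + (0 : ℤ)) % ((2 : ℕ) : ℤ) - (0 : ℤ)) * (((2 * (d₀ : ℤ) + 2 * (d₂ : ℤ) - 4 * (d₃ : ℤ)) + (0 : ℤ)) % ((2 : ℕ) : ℤ) - (0 : ℤ)) < ((2 : ℕ) : ℤ) ^ 2)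 ∨
      (0 < (((-(d₀ : ℤ) - 2 * (d₁ : ℤ) - 2 * (d₂ : ℤ) + (d₃ : ℤ)) + (0 : ℤ)) % ((2 : ℕ) : ℤ) - (0 : ℤ)) ^ 2 + 2 * ((((d₀ : ℤ) - (d₁ : ℤ) - (d₂ : ℤ) - (d₃ : ℤ)) + (0 : ℤ)) % ((2 : ℕ) : ℤ) - (0 : ℤ)) ^ 2 + 4 * ((((d₁ : ℤ) + (d₃ : ℤ)) + (0 : ℤ)) % ((2 : ℕ) : ℤ) - (0 : ℤ)) ^ 2 + 2 * (((-(d₀ : ℤ) - 2 * (d₂ : ℤ)) + (0 : ℤ)) % ((2 : ℕ) : ℤ) - (0 : ℤ)) ^ 2 + (((-(d₀ : ℤ) - 2 * (d₁ : ℤ) - 2 * (d₂ : ℤ) + (d₃ : ℤ)) + (0 : ℤ)) % ((2 : ℕ) : ℤ) - (0 : ℤ)) * ((((d₁ : ℤ) + (d₃ : ℤ)) + (0 : ℤ)) % ((2 : ℕ) : ℤ) - (0 : ℤ)) - (((-(d₀ : ℤ) - 2 * (d₁ : ℤ) - 2 * (d₂ : ℤ) + (d₃ : ℤ)) + (0 :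 ℤ)) % ((2 : ℕ) : ℤ) - (0 : ℤ)) * (((-(d₀ : ℤ) - 2 * (d₂ : ℤ)) + (0 : ℤ)) % ((2 : ℕ) : ℤ) - (0 : ℤ)) + 2 * ((((d₀ : ℤ) - (d₁ : ℤ) - (d₂ : ℤ) - (d₃ : ℤ)) + (0 : ℤ)) % ((2 : ℕ) : ℤ) - (0 : ℤ)) * ((((d₁ : ℤ) + (d₃ : ℤ)) + (0 : ℤ)) % ((2 : ℕ) : ℤ) - (0 : ℤ)) + ((((d₀ : ℤ) - (d₁ : ℤ) - (d₂ : ℤ) - (d₃ : ℤ)) + (0 : ℤ)) % ((2 : ℕ) : ℤ) - (0 : ℤ)) * (((-(d₀ : ℤ) - 2 * (d₂ : ℤ)) + (0 : ℤ)) % ((2 : ℕ) : ℤ) - (0 : ℤ)) ∧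
        (((-(d₀ : ℤ) - 2 * (d₁ : ℤ) - 2 * (d₂ : ℤ) + (d₃ : ℤ)) + (0 : ℤ)) % ((2 : ℕ) : ℤ) - (0 : ℤ)) ^ 2 + 2 * ((((d₀ : ℤ) - (d₁ : ℤ) - (d₂ : ℤ) - (d₃ : ℤ)) + (0 : ℤ)) % ((2 : ℕ) : ℤ) - (0 : ℤ)) ^ 2 + 4 * ((((d₁ : ℤ) + (d₃ : ℤ)) + (0 : ℤ)) % ((2 : ℕ) : ℤ) - (0 : ℤ)) ^ 2 + 2 * (((-(d₀ : ℤ) - 2 * (d₂ : ℤ)) + (0 : ℤ)) % ((2 : ℕ) : ℤ) - (0 : ℤ)) ^ 2 + (((-(d₀ : ℤ) - 2 * (d₁ : ℤ) - 2 * (d₂ : ℤ) + (d₃ : ℤ)) + (0 : ℤ)) % ((2 : ℕ) : ℤ) - (0 : ℤ)) * ((((d₁ : ℤ) + (d₃ : ℤ)) + (0 : ℤ)) % ((2 : ℕ) : ℤ) - (0 : ℤ)) - (((-(d₀ : ℤ) - 2 * (d₁ : ℤ) - 2 * (d₂ : ℤ) + (d₃ : ℤ)) + (0 : ℤ)) %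 ((2 : ℕ) : ℤ) - (0 : ℤ)) * (((-(d₀ : ℤ) - 2 * (d₂ : ℤ)) + (0 : ℤ)) % ((2 : ℕ) : ℤ) - (0 : ℤ)) + 2 * ((((d₀ : ℤ) - (d₁ : ℤ) - (d₂ : ℤ) - (d₃ : ℤ)) + (0 : ℤ)) % ((2 : ℕ) : ℤ) - (0 : ℤ)) * ((((d₁ : ℤ) + (d₃ : ℤ)) + (0 : ℤ)) % ((2 : ℕ) : ℤ) - (0 : ℤ)) + ((((d₀ : ℤ) - (d₁ : ℤ) - (d₂ : ℤ) - (d₃ : ℤ)) + (0 : ℤ)) % ((2 : ℕ) : ℤ) - (0 : ℤ)) * (((-(d₀ : ℤ) - 2 * (d₂ : ℤ)) + (0 : ℤ)) % ((2 : ℕ) : ℤ) - (0 : ℤ)) < ((2 : ℕ) : ℤ) ^ 2) ∨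
      (0 < (((2 * (d₁ : ℤ) + 2 * (d₂ : ℤ) - (d₃ : ℤ)) + (0 : ℤ)) % ((2 : ℕ) : ℤ) - (0 : ℤ)) ^ 2 + 2 * (((-(d₀ : ℤ) + (d₂ : ℤ) + (d₃ : ℤ)) + (0 : ℤ)) % ((2 : ℕ) : ℤ) - (0 : ℤ)) ^ 2 + 4 * (((-(d₁ : ℤ) - (d₂ : ℤ) - (d₃ : ℤ)) + (0 : ℤ)) % ((2 : ℕ) : ℤ) - (0 : ℤ)) ^ 2 + 2 * ((((d₀ : ℤ) + 2 * (d₂ : ℤ) - (d₃ : ℤ)) + (0 : ℤ)) % ((2 : ℕ) : ℤ) - (0 : ℤ)) ^ 2 + (((2 * (d₁ : ℤ) + 2 * (d₂ : ℤ) - (d₃ : ℤ)) + (0 : ℤ)) % ((2 : ℕ) : ℤ) - (0 : ℤ)) * (((-(d₁ : ℤ) - (d₂ : ℤ) - (d₃ : ℤ)) + (0 : ℤ)) % ((2 : ℕ) : ℤ) - (0 : ℤ)) - (((2 * (d₁ : ℤ) + 2 * (d₂ : ℤ) - (d₃ : ℤ)) + (0 : ℤ)) % ((2 : ℕ) : ℤ)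 - (0 : ℤ)) * ((((d₀ : ℤ) + 2 * (d₂ : ℤ) - (d₃ : ℤ)) + (0 : ℤ)) % ((2 : ℕ) : ℤ) - (0 : ℤ)) + 2 * (((-(d₀ : ℤ) + (d₂ : ℤ) + (d₃ : ℤ)) + (0 : ℤ)) % ((2 : ℕ) : ℤ) - (0 : ℤ)) * (((-(d₁ : ℤ) - (d₂ : ℤ) - (d₃ : ℤ)) + (0 : ℤ)) % ((2 : ℕ) : ℤ) - (0 : ℤ)) + (((-(d₀ : ℤ) + (d₂ : ℤ) + (d₃ : ℤ)) + (0 : ℤ)) % ((2 : ℕ) : ℤ) - (0 : ℤ)) * ((((d₀ : ℤ) + 2 * (d₂ : ℤ) - (d₃ : ℤ)) + (0 : ℤ)) % ((2 : ℕ) : ℤ) - (0 : ℤ)) ∧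
        (((2 * (d₁ : ℤ) + 2 * (d₂ : ℤ) - (d₃ : ℤ)) + (0 : ℤ)) % ((2 : ℕ) : ℤ) - (0 : ℤ)) ^ 2 + 2 * (((-(d₀ : ℤ) + (d₂ : ℤ) + (d₃ : ℤ)) + (0 : ℤ)) % ((2 : ℕ) : ℤ) - (0 : ℤ)) ^ 2 + 4 * (((-(d₁ : ℤ) - (d₂ : ℤ) - (d₃ : ℤ)) + (0 : ℤ)) % ((2 : ℕ) : ℤ) - (0 : ℤ)) ^ 2 + 2 * ((((d₀ : ℤ) + 2 * (d₂ : ℤ) - (d₃ : ℤ)) + (0 : ℤ)) % ((2 : ℕ) : ℤ) - (0 : ℤ)) ^ 2 + (((2 * (d₁ : ℤ) + 2 * (d₂ : ℤ) - (d₃ : ℤ)) + (0 : ℤ)) % ((2 : ℕ) : ℤ) - (0 : ℤ)) * (((-(d₁ : ℤ) - (d₂ : ℤ) - (d₃ : ℤ)) + (0 : ℤ)) % ((2 : ℕ) : ℤ) - (0 : ℤ)) - (((2 * (d₁ : ℤ) + 2 * (d₂ : ℤ) - (d₃ : ℤ)) + (0 : ℤ)) % ((2 : ℕ) : ℤ)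 - (0 : ℤ)) * ((((d₀ : ℤ) + 2 * (d₂ : ℤ) - (d₃ : ℤ)) + (0 : ℤ)) % ((2 : ℕ) : ℤ) - (0 : ℤ)) + 2 * (((-(d₀ : ℤ) + (d₂ : ℤ) + (d₃ : ℤ)) + (0 : ℤ)) % ((2 : ℕ) : ℤ) - (0 : ℤ)) * (((-(d₁ : ℤ) - (d₂ : ℤ) - (d₃ : ℤ)) + (0 : ℤ)) % ((2 : ℕ) : ℤ) - (0 : ℤ)) + (((-(d₀ : ℤ) + (d₂ : ℤ) + (d₃ : ℤ)) + (0 : ℤ)) % ((2 : ℕ) : ℤ) - (0 : ℤ)) * ((((d₀ : ℤ) + 2 * (d₂ : ℤ) - (d₃ : ℤ)) + (0 : ℤ)) % ((2 : ℕ) : ℤ) - (0 : ℤ)) < ((2 : ℕ) : ℤ) ^ 2) := by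
  decide +kernel

set_option synthInstance.maxHeartbeats 400000 in
set_option synthInstance.maxSize 4000 in
/-- **The Dedekind–Hasse certificate at `p = 3`**: for every residue `δ = d₀ + d₁i + d₂α + d₃η ∈ O₁₃ ∖ 3O₁₃` one of the five
multipliers `−1, η − 1, −2 − i + 2η, −1 + i − η, −i + η` gives a centred lift `c` of the coordinates of `δ·(multiplier)` mod `3`
with `0 < Q₁₃(c) < 3²` (checked by the kernel). [cite: CardosoMachiavelo2025, Thm. 7 and §5.2 Thm. 9 (the finite check for the discriminant-13 order)] -/
private theorem cert_3 : ∀ d₀ < (3 : ℕ), ∀ d₁ < (3 : ℕ), ∀ d₂ < (3 : ℕ), ∀ d₃ < (3 : ℕ),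
    (d₀ ≠ 0 ∨ d₁ ≠ 0 ∨ d₂ ≠ 0 ∨ d₃ ≠ 0) →
      (0 < (((-(d₀ : ℤ)) + (1 : ℤ)) % ((3 : ℕ) : ℤ) - (1 : ℤ)) ^ 2 + 2 * (((-(d₁ : ℤ)) + (1 : ℤ)) % ((3 : ℕ) : ℤ) - (1 : ℤ)) ^ 2 + 4 * (((-(d₂ : ℤ)) + (1 : ℤ)) % ((3 : ℕ) : ℤ) - (1 : ℤ)) ^ 2 + 2 * (((-(d₃ : ℤ)) + (1 : ℤ)) % ((3 : ℕ) : ℤ) - (1 : ℤ)) ^ 2 + (((-(d₀ : ℤ)) + (1 : ℤ)) % ((3 : ℕ) : ℤ) - (1 : ℤ)) * (((-(d₂ : ℤ)) + (1 : ℤ)) % ((3 : ℕ) : ℤ) - (1 : ℤ)) - (((-(d₀ : ℤ)) + (1 : ℤ)) % ((3 : ℕ) : ℤ) - (1 : ℤ)) * (((-(d₃ : ℤ)) + (1 : ℤ)) % ((3 : ℕ) : ℤ) - (1 : ℤ)) + 2 * (((-(d₁ : ℤ)) + (1 : ℤ)) % ((3 : ℕ) : ℤ) - (1 : ℤ)) *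 (((-(d₂ : ℤ)) + (1 : ℤ)) % ((3 : ℕ) : ℤ) - (1 : ℤ)) + (((-(d₁ : ℤ)) + (1 : ℤ)) % ((3 : ℕ) : ℤ) - (1 : ℤ)) * (((-(d₃ : ℤ)) + (1 : ℤ)) % ((3 : ℕ) : ℤ) - (1 : ℤ)) ∧
        (((-(d₀ : ℤ)) + (1 : ℤ)) % ((3 : ℕ) : ℤ) - (1 : ℤ)) ^ 2 + 2 * (((-(d₁ : ℤ)) + (1 : ℤ)) % ((3 : ℕ) : ℤ) - (1 : ℤ)) ^ 2 + 4 * (((-(d₂ : ℤ)) + (1 : ℤ)) % ((3 : ℕ) : ℤ) - (1 : ℤ)) ^ 2 + 2 * (((-(d₃ : ℤ)) + (1 : ℤ)) % ((3 : ℕ) : ℤ) - (1 : ℤ)) ^ 2 + (((-(d₀ : ℤ)) + (1 : ℤ)) % ((3 : ℕ) : ℤ) - (1 : ℤ)) * (((-(d₂ : ℤ)) + (1 : ℤ)) % ((3 : ℕ) : ℤ) - (1 : ℤ)) - (((-(d₀ : ℤ)) + (1 : ℤ)) % ((3 : ℕ) : ℤ) - (1 : ℤ)) * (((-(d₃ :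 ℤ)) + (1 : ℤ)) % ((3 : ℕ) : ℤ) - (1 : ℤ)) + 2 * (((-(d₁ : ℤ)) + (1 : ℤ)) % ((3 : ℕ) : ℤ) - (1 : ℤ)) * (((-(d₂ : ℤ)) + (1 : ℤ)) % ((3 : ℕ) : ℤ) - (1 : ℤ)) + (((-(d₁ : ℤ)) + (1 : ℤ)) % ((3 : ℕ) : ℤ) - (1 : ℤ)) * (((-(d₃ : ℤ)) + (1 : ℤ)) % ((3 : ℕ) : ℤ) - (1 : ℤ)) < ((3 : ℕ) : ℤ) ^ 2) ∨
      (0 < (((-(d₀ : ℤ) - 2 * (d₃ : ℤ)) + (1 : ℤ)) % ((3 : ℕ) : ℤ) - (1 : ℤ)) ^ 2 + 2 * (((-(d₁ : ℤ) + 2 * (d₂ : ℤ)) + (1 : ℤ)) % ((3 : ℕ) : ℤ) - (1 : ℤ)) ^ 2 + 4 * (((-(d₁ : ℤ) - 2 * (d₂ : ℤ)) + (1 : ℤ)) % ((3 : ℕ) : ℤ) - (1 : ℤ)) ^ 2 + 2 * ((((d₀ : ℤ) - 2 * (d₃ : ℤ)) + (1 : ℤ)) % ((3 : ℕ) : ℤ)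 - (1 : ℤ)) ^ 2 + (((-(d₀ : ℤ) - 2 * (d₃ : ℤ)) + (1 : ℤ)) % ((3 : ℕ) : ℤ) - (1 : ℤ)) * (((-(d₁ : ℤ) - 2 * (d₂ : ℤ)) + (1 : ℤ)) % ((3 : ℕ) : ℤ) - (1 : ℤ)) - (((-(d₀ : ℤ) - 2 * (d₃ : ℤ)) + (1 : ℤ)) % ((3 : ℕ) : ℤ) - (1 : ℤ)) * ((((d₀ : ℤ) - 2 * (d₃ : ℤ)) + (1 : ℤ)) % ((3 : ℕ) : ℤ) - (1 : ℤ)) + 2 * (((-(d₁ : ℤ) + 2 * (d₂ : ℤ)) + (1 : ℤ)) % ((3 : ℕ) : ℤ) - (1 : ℤ)) * (((-(d₁ : ℤ) - 2 * (d₂ : ℤ)) + (1 : ℤ)) % ((3 : ℕ) : ℤ) - (1 : ℤ)) + (((-(d₁ : ℤ) + 2 * (d₂ : ℤ)) + (1 : ℤ)) % ((3 : ℕ) : ℤ) - (1 : ℤ)) * ((((d₀ : ℤ) - 2 * (d₃ : ℤ)) + (1 : ℤ)) % ((3 : ℕ) : ℤ) - (1 : ℤ)) ∧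
        (((-(d₀ : ℤ) - 2 * (d₃ : ℤ)) + (1 : ℤ)) % ((3 : ℕ) : ℤ) - (1 : ℤ)) ^ 2 + 2 * (((-(d₁ : ℤ) + 2 * (d₂ : ℤ)) + (1 : ℤ)) % ((3 : ℕ) : ℤ) - (1 : ℤ)) ^ 2 + 4 * (((-(d₁ : ℤ) - 2 * (d₂ : ℤ)) + (1 : ℤ)) % ((3 : ℕ) : ℤ) - (1 : ℤ)) ^ 2 + 2 * ((((d₀ : ℤ) - 2 * (d₃ : ℤ)) + (1 : ℤ)) % ((3 : ℕ) : ℤ) - (1 : ℤ)) ^ 2 + (((-(d₀ : ℤ) - 2 * (d₃ : ℤ)) + (1 : ℤ)) % ((3 : ℕ) : ℤ) - (1 : ℤ)) * (((-(d₁ : ℤ) - 2 * (d₂ : ℤ)) + (1 : ℤ)) % ((3 : ℕ) : ℤ) - (1 : ℤ)) - (((-(d₀ : ℤ) - 2 * (d₃ : ℤ)) + (1 : ℤ)) % ((3 : ℕ) : ℤ) - (1 : ℤ)) * ((((d₀ : ℤ) - 2 * (d₃ : ℤ)) + (1 : ℤ)) % ((3 : ℕ) : ℤ) - (1 : ℤ))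 + 2 * (((-(d₁ : ℤ) + 2 * (d₂ : ℤ)) + (1 : ℤ)) % ((3 : ℕ) : ℤ) - (1 : ℤ)) * (((-(d₁ : ℤ) - 2 * (d₂ : ℤ)) + (1 : ℤ)) % ((3 : ℕ) : ℤ) - (1 : ℤ)) + (((-(d₁ : ℤ) + 2 * (d₂ : ℤ)) + (1 : ℤ)) % ((3 : ℕ) : ℤ) - (1 : ℤ)) * ((((d₀ : ℤ) - 2 * (d₃ : ℤ)) + (1 : ℤ)) % ((3 : ℕ) : ℤ) - (1 : ℤ)) < ((3 : ℕ) : ℤ) ^ 2) ∨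
      (0 < (((-2 * (d₀ : ℤ) + 2 * (d₁ : ℤ) + 2 * (d₂ : ℤ) - 3 * (d₃ : ℤ)) + (1 : ℤ)) % ((3 : ℕ) : ℤ) - (1 : ℤ)) ^ 2 + 2 * (((-(d₀ : ℤ) - 2 * (d₁ : ℤ) + 3 * (d₂ : ℤ) + (d₃ : ℤ)) + (1 : ℤ)) % ((3 : ℕ) : ℤ) - (1 : ℤ)) ^ 2 + 4 * (((-2 * (d₁ : ℤ) - 4 * (d₂ : ℤ) - (d₃ : ℤ)) + (1 : ℤ)) % ((3 : ℕ) : ℤ) - (1 : ℤ)) ^ 2 + 2 * (((2 * (d₀ : ℤ) + 2 * (d₂ : ℤ) - 4 * (d₃ : ℤ)) + (1 : ℤ)) % ((3 : ℕ) : ℤ) - (1 : ℤ)) ^ 2 + (((-2 * (d₀ : ℤ) + 2 * (d₁ : ℤ) + 2 * (d₂ : ℤ) - 3 * (d₃ : ℤ)) + (1 : ℤ)) % ((3 : ℕ) : ℤ) - (1 : ℤ)) * (((-2 * (d₁ : ℤ) - 4 * (d₂ : ℤ) - (d₃ : ℤ)) + (1 : ℤ)) % ((3 : ℕ) : ℤ)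 - (1 : ℤ)) - (((-2 * (d₀ : ℤ) + 2 * (d₁ : ℤ) + 2 * (d₂ : ℤ) - 3 * (d₃ : ℤ)) + (1 : ℤ)) % ((3 : ℕ) : ℤ) - (1 : ℤ)) * (((2 * (d₀ : ℤ) + 2 * (d₂ : ℤ) - 4 * (d₃ : ℤ)) + (1 : ℤ)) % ((3 : ℕ) : ℤ) - (1 : ℤ)) + 2 * (((-(d₀ : ℤ) - 2 * (d₁ : ℤ) + 3 * (d₂ : ℤ) + (d₃ : ℤ)) + (1 : ℤ)) % ((3 : ℕ) : ℤ) - (1 : ℤ)) * (((-2 * (d₁ : ℤ) - 4 * (d₂ : ℤ) - (d₃ : ℤ)) + (1 : ℤ)) % ((3 : ℕ) : ℤ) - (1 : ℤ)) + (((-(d₀ : ℤ) - 2 * (d₁ : ℤ) + 3 * (d₂ : ℤ) + (d₃ : ℤ)) + (1 : ℤ)) % ((3 : ℕ) : ℤ) - (1 : ℤ)) * (((2 * (d₀ : ℤ) + 2 * (d₂ : ℤ) - 4 * (d₃ : ℤ)) + (1 : ℤ)) % ((3 : ℕ) : ℤ) - (1 : ℤ)) ∧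
        (((-2 * (d₀ : ℤ) + 2 * (d₁ : ℤ) + 2 * (d₂ : ℤ) - 3 * (d₃ : ℤ)) + (1 : ℤ)) % ((3 : ℕ) : ℤ) - (1 : ℤ)) ^ 2 + 2 * (((-(d₀ : ℤ) - 2 * (d₁ : ℤ) + 3 * (d₂ : ℤ) + (d₃ : ℤ)) + (1 : ℤ)) % ((3 : ℕ) : ℤ) - (1 : ℤ)) ^ 2 + 4 * (((-2 * (d₁ : ℤ) - 4 * (d₂ : ℤ) - (d₃ : ℤ)) + (1 : ℤ)) % ((3 : ℕ) : ℤ) - (1 : ℤ)) ^ 2 + 2 * (((2 * (d₀ : ℤ) + 2 * (d₂ : ℤ) - 4 * (d₃ : ℤ)) + (1 : ℤ)) % ((3 : ℕ) : ℤ) - (1 : ℤ)) ^ 2 + (((-2 * (d₀ : ℤ) + 2 * (d₁ : ℤ) + 2 * (d₂ : ℤ) - 3 * (d₃ : ℤ)) + (1 : ℤ)) % ((3 : ℕ) : ℤ) - (1 : ℤ)) * (((-2 * (d₁ : ℤ) - 4 * (d₂ : ℤ) - (d₃ : ℤ)) + (1 : ℤ)) % ((3 : ℕ) : ℤ) - (1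 : ℤ)) - (((-2 * (d₀ : ℤ) + 2 * (d₁ : ℤ) + 2 * (d₂ : ℤ) - 3 * (d₃ : ℤ)) + (1 : ℤ)) % ((3 : ℕ) : ℤ) - (1 : ℤ)) * (((2 * (d₀ : ℤ) + 2 * (d₂ : ℤ) - 4 * (d₃ : ℤ)) + (1 : ℤ)) % ((3 : ℕ) : ℤ) - (1 : ℤ)) + 2 * (((-(d₀ : ℤ) - 2 * (d₁ : ℤ) + 3 * (d₂ : ℤ) + (d₃ : ℤ)) + (1 : ℤ)) % ((3 : ℕ) : ℤ) - (1 : ℤ)) * (((-2 * (d₁ : ℤ) - 4 * (d₂ : ℤ) - (d₃ : ℤ)) + (1 : ℤ)) % ((3 : ℕ) : ℤ) - (1 : ℤ)) + (((-(d₀ : ℤ) - 2 * (d₁ : ℤ) + 3 * (d₂ : ℤ) + (d₃ : ℤ)) + (1 : ℤ)) % ((3 : ℕ) : ℤ) - (1 : ℤ)) * (((2 * (d₀ : ℤ) + 2 * (d₂ : ℤ) - 4 * (d₃ : ℤ)) + (1 : ℤ)) % ((3 : ℕ) : ℤ) - (1 : ℤ)) < ((3 : ℕ) : ℤ) ^ 2)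 ∨
      (0 < (((-(d₀ : ℤ) - 2 * (d₁ : ℤ) - 2 * (d₂ : ℤ) + (d₃ : ℤ)) + (1 : ℤ)) % ((3 : ℕ) : ℤ) - (1 : ℤ)) ^ 2 + 2 * ((((d₀ : ℤ) - (d₁ : ℤ) - (d₂ : ℤ) - (d₃ : ℤ)) + (1 : ℤ)) % ((3 : ℕ) : ℤ) - (1 : ℤ)) ^ 2 + 4 * ((((d₁ : ℤ) + (d₃ : ℤ)) + (1 : ℤ)) % ((3 : ℕ) : ℤ) - (1 : ℤ)) ^ 2 + 2 * (((-(d₀ : ℤ) - 2 * (d₂ : ℤ)) + (1 : ℤ)) % ((3 : ℕ) : ℤ) - (1 : ℤ)) ^ 2 + (((-(d₀ : ℤ) - 2 * (d₁ : ℤ) - 2 * (d₂ : ℤ) + (d₃ : ℤ)) + (1 : ℤ)) % ((3 : ℕ) : ℤ) - (1 : ℤ)) * ((((d₁ : ℤ) + (d₃ : ℤ)) + (1 : ℤ)) % ((3 : ℕ) : ℤ) - (1 : ℤ)) - (((-(d₀ : ℤ) - 2 * (d₁ : ℤ) - 2 * (d₂ : ℤ) + (d₃ : ℤ)) + (1 :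 ℤ)) % ((3 : ℕ) : ℤ) - (1 : ℤ)) * (((-(d₀ : ℤ) - 2 * (d₂ : ℤ)) + (1 : ℤ)) % ((3 : ℕ) : ℤ) - (1 : ℤ)) + 2 * ((((d₀ : ℤ) - (d₁ : ℤ) - (d₂ : ℤ) - (d₃ : ℤ)) + (1 : ℤ)) % ((3 : ℕ) : ℤ) - (1 : ℤ)) * ((((d₁ : ℤ) + (d₃ : ℤ)) + (1 : ℤ)) % ((3 : ℕ) : ℤ) - (1 : ℤ)) + ((((d₀ : ℤ) - (d₁ : ℤ) - (d₂ : ℤ) - (d₃ : ℤ)) + (1 : ℤ)) % ((3 : ℕ) : ℤ) - (1 : ℤ)) * (((-(d₀ : ℤ) - 2 * (d₂ : ℤ)) + (1 : ℤ)) % ((3 : ℕ) : ℤ) - (1 : ℤ)) ∧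
        (((-(d₀ : ℤ) - 2 * (d₁ : ℤ) - 2 * (d₂ : ℤ) + (d₃ : ℤ)) + (1 : ℤ)) % ((3 : ℕ) : ℤ) - (1 : ℤ)) ^ 2 + 2 * ((((d₀ : ℤ) - (d₁ : ℤ) - (d₂ : ℤ) - (d₃ : ℤ)) + (1 : ℤ)) % ((3 : ℕ) : ℤ) - (1 : ℤ)) ^ 2 + 4 * ((((d₁ : ℤ) + (d₃ : ℤ)) + (1 : ℤ)) % ((3 : ℕ) : ℤ) - (1 : ℤ)) ^ 2 + 2 * (((-(d₀ : ℤ) - 2 * (d₂ : ℤ)) + (1 : ℤ)) % ((3 : ℕ) : ℤ) - (1 : ℤ)) ^ 2 + (((-(d₀ : ℤ) - 2 * (d₁ : ℤ) - 2 * (d₂ : ℤ) + (d₃ : ℤ)) + (1 : ℤ)) % ((3 : ℕ) : ℤ) - (1 : ℤ)) * ((((d₁ : ℤ) + (d₃ : ℤ)) + (1 : ℤ)) % ((3 : ℕ) : ℤ) - (1 : ℤ)) - (((-(d₀ : ℤ) - 2 * (d₁ : ℤ) - 2 * (d₂ : ℤ) + (d₃ : ℤ)) + (1 : ℤ)) %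 ((3 : ℕ) : ℤ) - (1 : ℤ)) * (((-(d₀ : ℤ) - 2 * (d₂ : ℤ)) + (1 : ℤ)) % ((3 : ℕ) : ℤ) - (1 : ℤ)) + 2 * ((((d₀ : ℤ) - (d₁ : ℤ) - (d₂ : ℤ) - (d₃ : ℤ)) + (1 : ℤ)) % ((3 : ℕ) : ℤ) - (1 : ℤ)) * ((((d₁ : ℤ) + (d₃ : ℤ)) + (1 : ℤ)) % ((3 : ℕ) : ℤ) - (1 : ℤ)) + ((((d₀ : ℤ) - (d₁ : ℤ) - (d₂ : ℤ) - (d₃ : ℤ)) + (1 : ℤ)) % ((3 : ℕ) : ℤ) - (1 : ℤ)) * (((-(d₀ : ℤ) - 2 * (d₂ : ℤ)) + (1 : ℤ)) % ((3 : ℕ) : ℤ) - (1 : ℤ)) < ((3 : ℕ) : ℤ) ^ 2) ∨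
      (0 < (((2 * (d₁ : ℤ) + 2 * (d₂ : ℤ) - (d₃ : ℤ)) + (1 : ℤ)) % ((3 : ℕ) : ℤ) - (1 : ℤ)) ^ 2 + 2 * (((-(d₀ : ℤ) + (d₂ : ℤ) + (d₃ : ℤ)) + (1 : ℤ)) % ((3 : ℕ) : ℤ) - (1 : ℤ)) ^ 2 + 4 * (((-(d₁ : ℤ) - (d₂ : ℤ) - (d₃ : ℤ)) + (1 : ℤ)) % ((3 : ℕ) : ℤ) - (1 : ℤ)) ^ 2 + 2 * ((((d₀ : ℤ) + 2 * (d₂ : ℤ) - (d₃ : ℤ)) + (1 : ℤ)) % ((3 : ℕ) : ℤ) - (1 : ℤ)) ^ 2 + (((2 * (d₁ : ℤ) + 2 * (d₂ : ℤ) - (d₃ : ℤ)) + (1 : ℤ)) % ((3 : ℕ) : ℤ) - (1 : ℤ)) * (((-(d₁ : ℤ) - (d₂ : ℤ) - (d₃ : ℤ)) + (1 : ℤ)) % ((3 : ℕ) : ℤ) - (1 : ℤ)) - (((2 * (d₁ : ℤ) + 2 * (d₂ : ℤ) - (d₃ : ℤ)) + (1 : ℤ)) % ((3 : ℕ) : ℤ)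 - (1 : ℤ)) * ((((d₀ : ℤ) + 2 * (d₂ : ℤ) - (d₃ : ℤ)) + (1 : ℤ)) % ((3 : ℕ) : ℤ) - (1 : ℤ)) + 2 * (((-(d₀ : ℤ) + (d₂ : ℤ) + (d₃ : ℤ)) + (1 : ℤ)) % ((3 : ℕ) : ℤ) - (1 : ℤ)) * (((-(d₁ : ℤ) - (d₂ : ℤ) - (d₃ : ℤ)) + (1 : ℤ)) % ((3 : ℕ) : ℤ) - (1 : ℤ)) + (((-(d₀ : ℤ) + (d₂ : ℤ) + (d₃ : ℤ)) + (1 : ℤ)) % ((3 : ℕ) : ℤ) - (1 : ℤ)) * ((((d₀ : ℤ) + 2 * (d₂ : ℤ) - (d₃ : ℤ)) + (1 : ℤ)) % ((3 : ℕ) : ℤ) - (1 : ℤ)) ∧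
        (((2 * (d₁ : ℤ) + 2 * (d₂ : ℤ) - (d₃ : ℤ)) + (1 : ℤ)) % ((3 : ℕ) : ℤ) - (1 : ℤ)) ^ 2 + 2 * (((-(d₀ : ℤ) + (d₂ : ℤ) + (d₃ : ℤ)) + (1 : ℤ)) % ((3 : ℕ) : ℤ) - (1 : ℤ)) ^ 2 + 4 * (((-(d₁ : ℤ) - (d₂ : ℤ) - (d₃ : ℤ)) + (1 : ℤ)) % ((3 : ℕ) : ℤ) - (1 : ℤ)) ^ 2 + 2 * ((((d₀ : ℤ) + 2 * (d₂ : ℤ) - (d₃ : ℤ)) + (1 : ℤ)) % ((3 : ℕ) : ℤ) - (1 : ℤ)) ^ 2 + (((2 * (d₁ : ℤ) + 2 * (d₂ : ℤ) - (d₃ : ℤ)) + (1 : ℤ)) % ((3 : ℕ) : ℤ) - (1 : ℤ)) * (((-(d₁ : ℤ) - (d₂ : ℤ) - (d₃ : ℤ)) + (1 : ℤ)) % ((3 : ℕ) : ℤ) - (1 : ℤ)) - (((2 * (d₁ : ℤ) + 2 * (d₂ : ℤ) - (d₃ : ℤ)) + (1 : ℤ)) % ((3 : ℕ) : ℤ)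 - (1 : ℤ)) * ((((d₀ : ℤ) + 2 * (d₂ : ℤ) - (d₃ : ℤ)) + (1 : ℤ)) % ((3 : ℕ) : ℤ) - (1 : ℤ)) + 2 * (((-(d₀ : ℤ) + (d₂ : ℤ) + (d₃ : ℤ)) + (1 : ℤ)) % ((3 : ℕ) : ℤ) - (1 : ℤ)) * (((-(d₁ : ℤ) - (d₂ : ℤ) - (d₃ : ℤ)) + (1 : ℤ)) % ((3 : ℕ) : ℤ) - (1 : ℤ)) + (((-(d₀ : ℤ) + (d₂ : ℤ) + (d₃ : ℤ)) + (1 : ℤ)) % ((3 : ℕ) : ℤ) - (1 : ℤ)) * ((((d₀ : ℤ) + 2 * (d₂ : ℤ) - (d₃ : ℤ)) + (1 : ℤ)) % ((3 : ℕ) : ℤ) - (1 : ℤ)) < ((3 : ℕ) : ℤ) ^ 2) := by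
  decide +kernel

set_option synthInstance.maxHeartbeats 400000 in
set_option synthInstance.maxSize 4000 in
/-- **The Dedekind–Hasse certificate at `p = 5`**: for every residue `δ = d₀ + d₁i + d₂α + d₃η ∈ O₁₃ ∖ 5O₁₃` one of the five
multipliers `−1, η − 1, −2 − i + 2η, −1 + i − η, −i + η` gives a centred lift `c` of the coordinates of `δ·(multiplier)` mod `5`
with `0 < Q₁₃(c) < 5²` (checked by the kernel). [cite: CardosoMachiavelo2025, Thm. 7 and §5.2 Thm. 9 (the finite check for the discriminant-13 order)] -/
private theorem cert_5 : ∀ d₀ < (5 : ℕ), ∀ d₁ < (5 : ℕ), ∀ d₂ < (5 : ℕ), ∀ d₃ < (5 : ℕ),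
    (d₀ ≠ 0 ∨ d₁ ≠ 0 ∨ d₂ ≠ 0 ∨ d₃ ≠ 0) →
      (0 < (((-(d₀ : ℤ)) + (2 : ℤ)) % ((5 : ℕ) : ℤ) - (2 : ℤ)) ^ 2 + 2 * (((-(d₁ : ℤ)) + (2 : ℤ)) % ((5 : ℕ) : ℤ) - (2 : ℤ)) ^ 2 + 4 * (((-(d₂ : ℤ)) + (2 : ℤ)) % ((5 : ℕ) : ℤ) - (2 : ℤ)) ^ 2 + 2 * (((-(d₃ : ℤ)) + (2 : ℤ)) % ((5 : ℕ) : ℤ) - (2 : ℤ)) ^ 2 + (((-(d₀ : ℤ)) + (2 : ℤ)) % ((5 : ℕ) : ℤ) - (2 : ℤ)) * (((-(d₂ : ℤ)) + (2 : ℤ)) % ((5 : ℕ) : ℤ) - (2 : ℤ)) - (((-(d₀ : ℤ)) + (2 : ℤ)) % ((5 : ℕ) : ℤ) - (2 : ℤ)) * (((-(d₃ : ℤ)) + (2 : ℤ)) % ((5 : ℕ) : ℤ) - (2 : ℤ)) + 2 * (((-(d₁ : ℤ)) + (2 : ℤ)) % ((5 : ℕ) : ℤ) - (2 : ℤ)) *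 (((-(d₂ : ℤ)) + (2 : ℤ)) % ((5 : ℕ) : ℤ) - (2 : ℤ)) + (((-(d₁ : ℤ)) + (2 : ℤ)) % ((5 : ℕ) : ℤ) - (2 : ℤ)) * (((-(d₃ : ℤ)) + (2 : ℤ)) % ((5 : ℕ) : ℤ) - (2 : ℤ)) ∧
        (((-(d₀ : ℤ)) + (2 : ℤ)) % ((5 : ℕ) : ℤ) - (2 : ℤ)) ^ 2 + 2 * (((-(d₁ : ℤ)) + (2 : ℤ)) % ((5 : ℕ) : ℤ) - (2 : ℤ)) ^ 2 + 4 * (((-(d₂ : ℤ)) + (2 : ℤ)) % ((5 : ℕ) : ℤ) - (2 : ℤ)) ^ 2 + 2 * (((-(d₃ : ℤ)) + (2 : ℤ)) % ((5 : ℕ) : ℤ) - (2 : ℤ)) ^ 2 + (((-(d₀ : ℤ)) + (2 : ℤ)) % ((5 : ℕ) : ℤ) - (2 : ℤ)) * (((-(d₂ : ℤ)) + (2 : ℤ)) % ((5 : ℕ) : ℤ) - (2 : ℤ)) - (((-(d₀ : ℤ)) + (2 : ℤ)) % ((5 : ℕ) : ℤ) - (2 : ℤ)) * (((-(d₃ :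 ℤ)) + (2 : ℤ)) % ((5 : ℕ) : ℤ) - (2 : ℤ)) + 2 * (((-(d₁ : ℤ)) + (2 : ℤ)) % ((5 : ℕ) : ℤ) - (2 : ℤ)) * (((-(d₂ : ℤ)) + (2 : ℤ)) % ((5 : ℕ) : ℤ) - (2 : ℤ)) + (((-(d₁ : ℤ)) + (2 : ℤ)) % ((5 : ℕ) : ℤ) - (2 : ℤ)) * (((-(d₃ : ℤ)) + (2 : ℤ)) % ((5 : ℕ) : ℤ) - (2 : ℤ)) < ((5 : ℕ) : ℤ) ^ 2) ∨
      (0 < (((-(d₀ : ℤ) - 2 * (d₃ : ℤ)) + (2 : ℤ)) % ((5 : ℕ) : ℤ) - (2 : ℤ)) ^ 2 + 2 * (((-(d₁ : ℤ) + 2 * (d₂ : ℤ)) + (2 : ℤ)) % ((5 : ℕ) : ℤ) - (2 : ℤ)) ^ 2 + 4 * (((-(d₁ : ℤ) - 2 * (d₂ : ℤ)) + (2 : ℤ)) % ((5 : ℕ) : ℤ) - (2 : ℤ)) ^ 2 + 2 * ((((d₀ : ℤ) - 2 * (d₃ : ℤ)) + (2 : ℤ)) % ((5 : ℕ) : ℤ)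 - (2 : ℤ)) ^ 2 + (((-(d₀ : ℤ) - 2 * (d₃ : ℤ)) + (2 : ℤ)) % ((5 : ℕ) : ℤ) - (2 : ℤ)) * (((-(d₁ : ℤ) - 2 * (d₂ : ℤ)) + (2 : ℤ)) % ((5 : ℕ) : ℤ) - (2 : ℤ)) - (((-(d₀ : ℤ) - 2 * (d₃ : ℤ)) + (2 : ℤ)) % ((5 : ℕ) : ℤ) - (2 : ℤ)) * ((((d₀ : ℤ) - 2 * (d₃ : ℤ)) + (2 : ℤ)) % ((5 : ℕ) : ℤ) - (2 : ℤ)) + 2 * (((-(d₁ : ℤ) + 2 * (d₂ : ℤ)) + (2 : ℤ)) % ((5 : ℕ) : ℤ) - (2 : ℤ)) * (((-(d₁ : ℤ) - 2 * (d₂ : ℤ)) + (2 : ℤ)) % ((5 : ℕ) : ℤ) - (2 : ℤ)) + (((-(d₁ : ℤ) + 2 * (d₂ : ℤ)) + (2 : ℤ)) % ((5 : ℕ) : ℤ) - (2 : ℤ)) * ((((d₀ : ℤ) - 2 * (d₃ : ℤ)) + (2 : ℤ)) % ((5 : ℕ) : ℤ) - (2 : ℤ)) ∧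
        (((-(d₀ : ℤ) - 2 * (d₃ : ℤ)) + (2 : ℤ)) % ((5 : ℕ) : ℤ) - (2 : ℤ)) ^ 2 + 2 * (((-(d₁ : ℤ) + 2 * (d₂ : ℤ)) + (2 : ℤ)) % ((5 : ℕ) : ℤ) - (2 : ℤ)) ^ 2 + 4 * (((-(d₁ : ℤ) - 2 * (d₂ : ℤ)) + (2 : ℤ)) % ((5 : ℕ) : ℤ) - (2 : ℤ)) ^ 2 + 2 * ((((d₀ : ℤ) - 2 * (d₃ : ℤ)) + (2 : ℤ)) % ((5 : ℕ) : ℤ) - (2 : ℤ)) ^ 2 + (((-(d₀ : ℤ) - 2 * (d₃ : ℤ)) + (2 : ℤ)) % ((5 : ℕ) : ℤ) - (2 : ℤ)) * (((-(d₁ : ℤ) - 2 * (d₂ : ℤ)) + (2 : ℤ)) % ((5 : ℕ) : ℤ) - (2 : ℤ)) - (((-(d₀ : ℤ) - 2 * (d₃ : ℤ)) + (2 : ℤ)) % ((5 : ℕ) : ℤ) - (2 : ℤ)) * ((((d₀ : ℤ) - 2 * (d₃ : ℤ)) + (2 : ℤ)) % ((5 : ℕ) : ℤ) - (2 : ℤ))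 + 2 * (((-(d₁ : ℤ) + 2 * (d₂ : ℤ)) + (2 : ℤ)) % ((5 : ℕ) : ℤ) - (2 : ℤ)) * (((-(d₁ : ℤ) - 2 * (d₂ : ℤ)) + (2 : ℤ)) % ((5 : ℕ) : ℤ) - (2 : ℤ)) + (((-(d₁ : ℤ) + 2 * (d₂ : ℤ)) + (2 : ℤ)) % ((5 : ℕ) : ℤ) - (2 : ℤ)) * ((((d₀ : ℤ) - 2 * (d₃ : ℤ)) + (2 : ℤ)) % ((5 : ℕ) : ℤ) - (2 : ℤ)) < ((5 : ℕ) : ℤ) ^ 2) ∨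
      (0 < (((-2 * (d₀ : ℤ) + 2 * (d₁ : ℤ) + 2 * (d₂ : ℤ) - 3 * (d₃ : ℤ)) + (2 : ℤ)) % ((5 : ℕ) : ℤ) - (2 : ℤ)) ^ 2 + 2 * (((-(d₀ : ℤ) - 2 * (d₁ : ℤ) + 3 * (d₂ : ℤ) + (d₃ : ℤ)) + (2 : ℤ)) % ((5 : ℕ) : ℤ) - (2 : ℤ)) ^ 2 + 4 * (((-2 * (d₁ : ℤ) - 4 * (d₂ : ℤ) - (d₃ : ℤ)) + (2 : ℤ)) % ((5 : ℕ) : ℤ) - (2 : ℤ)) ^ 2 + 2 * (((2 * (d₀ : ℤ) + 2 * (d₂ : ℤ) - 4 * (d₃ : ℤ)) + (2 : ℤ)) % ((5 : ℕ) : ℤ) - (2 : ℤ)) ^ 2 + (((-2 * (d₀ : ℤ) + 2 * (d₁ : ℤ) + 2 * (d₂ : ℤ) - 3 * (d₃ : ℤ)) + (2 : ℤ)) % ((5 : ℕ) : ℤ) - (2 : ℤ)) * (((-2 * (d₁ : ℤ) - 4 * (d₂ : ℤ) - (d₃ : ℤ)) + (2 : ℤ)) % ((5 : ℕ) : ℤ)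 - (2 : ℤ)) - (((-2 * (d₀ : ℤ) + 2 * (d₁ : ℤ) + 2 * (d₂ : ℤ) - 3 * (d₃ : ℤ)) + (2 : ℤ)) % ((5 : ℕ) : ℤ) - (2 : ℤ)) * (((2 * (d₀ : ℤ) + 2 * (d₂ : ℤ) - 4 * (d₃ : ℤ)) + (2 : ℤ)) % ((5 : ℕ) : ℤ) - (2 : ℤ)) + 2 * (((-(d₀ : ℤ) - 2 * (d₁ : ℤ) + 3 * (d₂ : ℤ) + (d₃ : ℤ)) + (2 : ℤ)) % ((5 : ℕ) : ℤ) - (2 : ℤ)) * (((-2 * (d₁ : ℤ) - 4 * (d₂ : ℤ) - (d₃ : ℤ)) + (2 : ℤ)) % ((5 : ℕ) : ℤ) - (2 : ℤ)) + (((-(d₀ : ℤ) - 2 * (d₁ : ℤ) + 3 * (d₂ : ℤ) + (d₃ : ℤ)) + (2 : ℤ)) % ((5 : ℕ) : ℤ) - (2 : ℤ)) * (((2 * (d₀ : ℤ) + 2 * (d₂ : ℤ) - 4 * (d₃ : ℤ)) + (2 : ℤ)) % ((5 : ℕ) : ℤ) - (2 : ℤ)) ∧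
        (((-2 * (d₀ : ℤ) + 2 * (d₁ : ℤ) + 2 * (d₂ : ℤ) - 3 * (d₃ : ℤ)) + (2 : ℤ)) % ((5 : ℕ) : ℤ) - (2 : ℤ)) ^ 2 + 2 * (((-(d₀ : ℤ) - 2 * (d₁ : ℤ) + 3 * (d₂ : ℤ) + (d₃ : ℤ)) + (2 : ℤ)) % ((5 : ℕ) : ℤ) - (2 : ℤ)) ^ 2 + 4 * (((-2 * (d₁ : ℤ) - 4 * (d₂ : ℤ) - (d₃ : ℤ)) + (2 : ℤ)) % ((5 : ℕ) : ℤ) - (2 : ℤ)) ^ 2 + 2 * (((2 * (d₀ : ℤ) + 2 * (d₂ : ℤ) - 4 * (d₃ : ℤ)) + (2 : ℤ)) % ((5 : ℕ) : ℤ) - (2 : ℤ)) ^ 2 + (((-2 * (d₀ : ℤ) + 2 * (d₁ : ℤ) + 2 * (d₂ : ℤ) - 3 * (d₃ : ℤ)) + (2 : ℤ)) % ((5 : ℕ) : ℤ) - (2 : ℤ)) * (((-2 * (d₁ : ℤ) - 4 * (d₂ : ℤ) - (d₃ : ℤ)) + (2 : ℤ)) % ((5 : ℕ) : ℤ) - (2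 : ℤ)) - (((-2 * (d₀ : ℤ) + 2 * (d₁ : ℤ) + 2 * (d₂ : ℤ) - 3 * (d₃ : ℤ)) + (2 : ℤ)) % ((5 : ℕ) : ℤ) - (2 : ℤ)) * (((2 * (d₀ : ℤ) + 2 * (d₂ : ℤ) - 4 * (d₃ : ℤ)) + (2 : ℤ)) % ((5 : ℕ) : ℤ) - (2 : ℤ)) + 2 * (((-(d₀ : ℤ) - 2 * (d₁ : ℤ) + 3 * (d₂ : ℤ) + (d₃ : ℤ)) + (2 : ℤ)) % ((5 : ℕ) : ℤ) - (2 : ℤ)) * (((-2 * (d₁ : ℤ) - 4 * (d₂ : ℤ) - (d₃ : ℤ)) + (2 : ℤ)) % ((5 : ℕ) : ℤ) - (2 : ℤ)) + (((-(d₀ : ℤ) - 2 * (d₁ : ℤ) + 3 * (d₂ : ℤ) + (d₃ : ℤ)) + (2 : ℤ)) % ((5 : ℕ) : ℤ) - (2 : ℤ)) * (((2 * (d₀ : ℤ) + 2 * (d₂ : ℤ) - 4 * (d₃ : ℤ)) + (2 : ℤ)) % ((5 : ℕ) : ℤ) - (2 : ℤ)) < ((5 : ℕ) : ℤ) ^ 2)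 ∨
      (0 < (((-(d₀ : ℤ) - 2 * (d₁ : ℤ) - 2 * (d₂ : ℤ) + (d₃ : ℤ)) + (2 : ℤ)) % ((5 : ℕ) : ℤ) - (2 : ℤ)) ^ 2 + 2 * ((((d₀ : ℤ) - (d₁ : ℤ) - (d₂ : ℤ) - (d₃ : ℤ)) + (2 : ℤ)) % ((5 : ℕ) : ℤ) - (2 : ℤ)) ^ 2 + 4 * ((((d₁ : ℤ) + (d₃ : ℤ)) + (2 : ℤ)) % ((5 : ℕ) : ℤ) - (2 : ℤ)) ^ 2 + 2 * (((-(d₀ : ℤ) - 2 * (d₂ : ℤ)) + (2 : ℤ)) % ((5 : ℕ) : ℤ) - (2 : ℤ)) ^ 2 + (((-(d₀ : ℤ) - 2 * (d₁ : ℤ) - 2 * (d₂ : ℤ) + (d₃ : ℤ)) + (2 : ℤ)) % ((5 : ℕ) : ℤ) - (2 : ℤ)) * ((((d₁ : ℤ) + (d₃ : ℤ)) + (2 : ℤ)) % ((5 : ℕ) : ℤ) - (2 : ℤ)) - (((-(d₀ : ℤ) - 2 * (d₁ : ℤ) - 2 * (d₂ : ℤ) + (d₃ : ℤ)) + (2 :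 ℤ)) % ((5 : ℕ) : ℤ) - (2 : ℤ)) * (((-(d₀ : ℤ) - 2 * (d₂ : ℤ)) + (2 : ℤ)) % ((5 : ℕ) : ℤ) - (2 : ℤ)) + 2 * ((((d₀ : ℤ) - (d₁ : ℤ) - (d₂ : ℤ) - (d₃ : ℤ)) + (2 : ℤ)) % ((5 : ℕ) : ℤ) - (2 : ℤ)) * ((((d₁ : ℤ) + (d₃ : ℤ)) + (2 : ℤ)) % ((5 : ℕ) : ℤ) - (2 : ℤ)) + ((((d₀ : ℤ) - (d₁ : ℤ) - (d₂ : ℤ) - (d₃ : ℤ)) + (2 : ℤ)) % ((5 : ℕ) : ℤ) - (2 : ℤ)) * (((-(d₀ : ℤ) - 2 * (d₂ : ℤ)) + (2 : ℤ)) % ((5 : ℕ) : ℤ) - (2 : ℤ)) ∧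
        (((-(d₀ : ℤ) - 2 * (d₁ : ℤ) - 2 * (d₂ : ℤ) + (d₃ : ℤ)) + (2 : ℤ)) % ((5 : ℕ) : ℤ) - (2 : ℤ)) ^ 2 + 2 * ((((d₀ : ℤ) - (d₁ : ℤ) - (d₂ : ℤ) - (d₃ : ℤ)) + (2 : ℤ)) % ((5 : ℕ) : ℤ) - (2 : ℤ)) ^ 2 + 4 * ((((d₁ : ℤ) + (d₃ : ℤ)) + (2 : ℤ)) % ((5 : ℕ) : ℤ) - (2 : ℤ)) ^ 2 + 2 * (((-(d₀ : ℤ) - 2 * (d₂ : ℤ)) + (2 : ℤ)) % ((5 : ℕ) : ℤ) - (2 : ℤ)) ^ 2 + (((-(d₀ : ℤ) - 2 * (d₁ : ℤ) - 2 * (d₂ : ℤ) + (d₃ : ℤ)) + (2 : ℤ)) % ((5 : ℕ) : ℤ) - (2 : ℤ)) * ((((d₁ : ℤ) + (d₃ : ℤ)) + (2 : ℤ)) % ((5 : ℕ) : ℤ) - (2 : ℤ)) - (((-(d₀ : ℤ) - 2 * (d₁ : ℤ) - 2 * (d₂ : ℤ) + (d₃ : ℤ)) + (2 : ℤ)) %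 ((5 : ℕ) : ℤ) - (2 : ℤ)) * (((-(d₀ : ℤ) - 2 * (d₂ : ℤ)) + (2 : ℤ)) % ((5 : ℕ) : ℤ) - (2 : ℤ)) + 2 * ((((d₀ : ℤ) - (d₁ : ℤ) - (d₂ : ℤ) - (d₃ : ℤ)) + (2 : ℤ)) % ((5 : ℕ) : ℤ) - (2 : ℤ)) * ((((d₁ : ℤ) + (d₃ : ℤ)) + (2 : ℤ)) % ((5 : ℕ) : ℤ) - (2 : ℤ)) + ((((d₀ : ℤ) - (d₁ : ℤ) - (d₂ : ℤ) - (d₃ : ℤ)) + (2 : ℤ)) % ((5 : ℕ) : ℤ) - (2 : ℤ)) * (((-(d₀ : ℤ) - 2 * (d₂ : ℤ)) + (2 : ℤ)) % ((5 : ℕ) : ℤ) - (2 : ℤ)) < ((5 : ℕ) : ℤ) ^ 2) ∨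
      (0 < (((2 * (d₁ : ℤ) + 2 * (d₂ : ℤ) - (d₃ : ℤ)) + (2 : ℤ)) % ((5 : ℕ) : ℤ) - (2 : ℤ)) ^ 2 + 2 * (((-(d₀ : ℤ) + (d₂ : ℤ) + (d₃ : ℤ)) + (2 : ℤ)) % ((5 : ℕ) : ℤ) - (2 : ℤ)) ^ 2 + 4 * (((-(d₁ : ℤ) - (d₂ : ℤ) - (d₃ : ℤ)) + (2 : ℤ)) % ((5 : ℕ) : ℤ) - (2 : ℤ)) ^ 2 + 2 * ((((d₀ : ℤ) + 2 * (d₂ : ℤ) - (d₃ : ℤ)) + (2 : ℤ)) % ((5 : ℕ) : ℤ) - (2 : ℤ)) ^ 2 + (((2 * (d₁ : ℤ) + 2 * (d₂ : ℤ) - (d₃ : ℤ)) + (2 : ℤ)) % ((5 : ℕ) : ℤ) - (2 : ℤ)) * (((-(d₁ : ℤ) - (d₂ : ℤ) - (d₃ : ℤ)) + (2 : ℤ)) % ((5 : ℕ) : ℤ) - (2 : ℤ)) - (((2 * (d₁ : ℤ) + 2 * (d₂ : ℤ) - (d₃ : ℤ)) + (2 : ℤ)) % ((5 : ℕ) : ℤ)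 - (2 : ℤ)) * ((((d₀ : ℤ) + 2 * (d₂ : ℤ) - (d₃ : ℤ)) + (2 : ℤ)) % ((5 : ℕ) : ℤ) - (2 : ℤ)) + 2 * (((-(d₀ : ℤ) + (d₂ : ℤ) + (d₃ : ℤ)) + (2 : ℤ)) % ((5 : ℕ) : ℤ) - (2 : ℤ)) * (((-(d₁ : ℤ) - (d₂ : ℤ) - (d₃ : ℤ)) + (2 : ℤ)) % ((5 : ℕ) : ℤ) - (2 : ℤ)) + (((-(d₀ : ℤ) + (d₂ : ℤ) + (d₃ : ℤ)) + (2 : ℤ)) % ((5 : ℕ) : ℤ) - (2 : ℤ)) * ((((d₀ : ℤ) + 2 * (d₂ : ℤ) - (d₃ : ℤ)) + (2 : ℤ)) % ((5 : ℕ) : ℤ) - (2 : ℤ)) ∧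
        (((2 * (d₁ : ℤ) + 2 * (d₂ : ℤ) - (d₃ : ℤ)) + (2 : ℤ)) % ((5 : ℕ) : ℤ) - (2 : ℤ)) ^ 2 + 2 * (((-(d₀ : ℤ) + (d₂ : ℤ) + (d₃ : ℤ)) + (2 : ℤ)) % ((5 : ℕ) : ℤ) - (2 : ℤ)) ^ 2 + 4 * (((-(d₁ : ℤ) - (d₂ : ℤ) - (d₃ : ℤ)) + (2 : ℤ)) % ((5 : ℕ) : ℤ) - (2 : ℤ)) ^ 2 + 2 * ((((d₀ : ℤ) + 2 * (d₂ : ℤ) - (d₃ : ℤ)) + (2 : ℤ)) % ((5 : ℕ) : ℤ) - (2 : ℤ)) ^ 2 + (((2 * (d₁ : ℤ) + 2 * (d₂ : ℤ) - (d₃ : ℤ)) + (2 : ℤ)) % ((5 : ℕ) : ℤ) - (2 : ℤ)) * (((-(d₁ : ℤ) - (d₂ : ℤ) - (d₃ : ℤ)) + (2 : ℤ)) % ((5 : ℕ) : ℤ) - (2 : ℤ)) - (((2 * (d₁ : ℤ) + 2 * (d₂ : ℤ) - (d₃ : ℤ)) + (2 : ℤ)) % ((5 : ℕ) : ℤ)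 - (2 : ℤ)) * ((((d₀ : ℤ) + 2 * (d₂ : ℤ) - (d₃ : ℤ)) + (2 : ℤ)) % ((5 : ℕ) : ℤ) - (2 : ℤ)) + 2 * (((-(d₀ : ℤ) + (d₂ : ℤ) + (d₃ : ℤ)) + (2 : ℤ)) % ((5 : ℕ) : ℤ) - (2 : ℤ)) * (((-(d₁ : ℤ) - (d₂ : ℤ) - (d₃ : ℤ)) + (2 : ℤ)) % ((5 : ℕ) : ℤ) - (2 : ℤ)) + (((-(d₀ : ℤ) + (d₂ : ℤ) + (d₃ : ℤ)) + (2 : ℤ)) % ((5 : ℕ) : ℤ) - (2 : ℤ)) * ((((d₀ : ℤ) + 2 * (d₂ : ℤ) - (d₃ : ℤ)) + (2 : ℤ)) % ((5 : ℕ) : ℤ) - (2 : ℤ)) < ((5 : ℕ) : ℤ) ^ 2) := by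
  decide +kernel

set_option synthInstance.maxHeartbeats 400000 in
set_option synthInstance.maxSize 4000 in
/-- **The Dedekind–Hasse certificate at `p = 7`**: for every residue `δ = d₀ + d₁i + d₂α + d₃η ∈ O₁₃ ∖ 7O₁₃` one of the five
multipliers `−1, η − 1, −2 − i + 2η, −1 + i − η, −i + η` gives a centred lift `c` of the coordinates of `δ·(multiplier)` mod `7`
with `0 < Q₁₃(c) < 7²` (checked by the kernel). [cite: CardosoMachiavelo2025, Thm. 7 and §5.2 Thm. 9 (the finite check for the discriminant-13 order)] -/
private theorem cert_7 : ∀ d₀ < (7 : ℕ), ∀ d₁ < (7 : ℕ), ∀ d₂ < (7 : ℕ), ∀ d₃ < (7 : ℕ),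
    (d₀ ≠ 0 ∨ d₁ ≠ 0 ∨ d₂ ≠ 0 ∨ d₃ ≠ 0) →
      (0 < (((-(d₀ : ℤ)) + (3 : ℤ)) % ((7 : ℕ) : ℤ) - (3 : ℤ)) ^ 2 + 2 * (((-(d₁ : ℤ)) + (3 : ℤ)) % ((7 : ℕ) : ℤ) - (3 : ℤ)) ^ 2 + 4 * (((-(d₂ : ℤ)) + (3 : ℤ)) % ((7 : ℕ) : ℤ) - (3 : ℤ)) ^ 2 + 2 * (((-(d₃ : ℤ)) + (3 : ℤ)) % ((7 : ℕ) : ℤ) - (3 : ℤ)) ^ 2 + (((-(d₀ : ℤ)) + (3 : ℤ)) % ((7 : ℕ) : ℤ) - (3 : ℤ)) * (((-(d₂ : ℤ)) + (3 : ℤ)) % ((7 : ℕ) : ℤ) - (3 : ℤ)) - (((-(d₀ : ℤ)) + (3 : ℤ)) % ((7 : ℕ) : ℤ) - (3 : ℤ)) * (((-(d₃ : ℤ)) + (3 : ℤ)) % ((7 : ℕ) : ℤ) - (3 : ℤ)) + 2 * (((-(d₁ : ℤ)) + (3 : ℤ)) % ((7 : ℕ) : ℤ) - (3 : ℤ)) *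 (((-(d₂ : ℤ)) + (3 : ℤ)) % ((7 : ℕ) : ℤ) - (3 : ℤ)) + (((-(d₁ : ℤ)) + (3 : ℤ)) % ((7 : ℕ) : ℤ) - (3 : ℤ)) * (((-(d₃ : ℤ)) + (3 : ℤ)) % ((7 : ℕ) : ℤ) - (3 : ℤ)) ∧
        (((-(d₀ : ℤ)) + (3 : ℤ)) % ((7 : ℕ) : ℤ) - (3 : ℤ)) ^ 2 + 2 * (((-(d₁ : ℤ)) + (3 : ℤ)) % ((7 : ℕ) : ℤ) - (3 : ℤ)) ^ 2 + 4 * (((-(d₂ : ℤ)) + (3 : ℤ)) % ((7 : ℕ) : ℤ) - (3 : ℤ)) ^ 2 + 2 * (((-(d₃ : ℤ)) + (3 : ℤ)) % ((7 : ℕ) : ℤ) - (3 : ℤ)) ^ 2 + (((-(d₀ : ℤ)) + (3 : ℤ)) % ((7 : ℕ) : ℤ) - (3 : ℤ)) * (((-(d₂ : ℤ)) + (3 : ℤ)) % ((7 : ℕ) : ℤ) - (3 : ℤ)) - (((-(d₀ : ℤ)) + (3 : ℤ)) % ((7 : ℕ) : ℤ) - (3 : ℤ)) * (((-(d₃ :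 ℤ)) + (3 : ℤ)) % ((7 : ℕ) : ℤ) - (3 : ℤ)) + 2 * (((-(d₁ : ℤ)) + (3 : ℤ)) % ((7 : ℕ) : ℤ) - (3 : ℤ)) * (((-(d₂ : ℤ)) + (3 : ℤ)) % ((7 : ℕ) : ℤ) - (3 : ℤ)) + (((-(d₁ : ℤ)) + (3 : ℤ)) % ((7 : ℕ) : ℤ) - (3 : ℤ)) * (((-(d₃ : ℤ)) + (3 : ℤ)) % ((7 : ℕ) : ℤ) - (3 : ℤ)) < ((7 : ℕ) : ℤ) ^ 2) ∨
      (0 < (((-(d₀ : ℤ) - 2 * (d₃ : ℤ)) + (3 : ℤ)) % ((7 : ℕ) : ℤ) - (3 : ℤ)) ^ 2 + 2 * (((-(d₁ : ℤ) + 2 * (d₂ : ℤ)) + (3 : ℤ)) % ((7 : ℕ) : ℤ) - (3 : ℤ)) ^ 2 + 4 * (((-(d₁ : ℤ) - 2 * (d₂ : ℤ)) + (3 : ℤ)) % ((7 : ℕ) : ℤ) - (3 : ℤ)) ^ 2 + 2 * ((((d₀ : ℤ) - 2 * (d₃ : ℤ)) + (3 : ℤ)) % ((7 : ℕ) : ℤ)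 - (3 : ℤ)) ^ 2 + (((-(d₀ : ℤ) - 2 * (d₃ : ℤ)) + (3 : ℤ)) % ((7 : ℕ) : ℤ) - (3 : ℤ)) * (((-(d₁ : ℤ) - 2 * (d₂ : ℤ)) + (3 : ℤ)) % ((7 : ℕ) : ℤ) - (3 : ℤ)) - (((-(d₀ : ℤ) - 2 * (d₃ : ℤ)) + (3 : ℤ)) % ((7 : ℕ) : ℤ) - (3 : ℤ)) * ((((d₀ : ℤ) - 2 * (d₃ : ℤ)) + (3 : ℤ)) % ((7 : ℕ) : ℤ) - (3 : ℤ)) + 2 * (((-(d₁ : ℤ) + 2 * (d₂ : ℤ)) + (3 : ℤ)) % ((7 : ℕ) : ℤ) - (3 : ℤ)) * (((-(d₁ : ℤ) - 2 * (d₂ : ℤ)) + (3 : ℤ)) % ((7 : ℕ) : ℤ) - (3 : ℤ)) + (((-(d₁ : ℤ) + 2 * (d₂ : ℤ)) + (3 : ℤ)) % ((7 : ℕ) : ℤ) - (3 : ℤ)) * ((((d₀ : ℤ) - 2 * (d₃ : ℤ)) + (3 : ℤ)) % ((7 : ℕ) : ℤ) - (3 : ℤ)) ∧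
        (((-(d₀ : ℤ) - 2 * (d₃ : ℤ)) + (3 : ℤ)) % ((7 : ℕ) : ℤ) - (3 : ℤ)) ^ 2 + 2 * (((-(d₁ : ℤ) + 2 * (d₂ : ℤ)) + (3 : ℤ)) % ((7 : ℕ) : ℤ) - (3 : ℤ)) ^ 2 + 4 * (((-(d₁ : ℤ) - 2 * (d₂ : ℤ)) + (3 : ℤ)) % ((7 : ℕ) : ℤ) - (3 : ℤ)) ^ 2 + 2 * ((((d₀ : ℤ) - 2 * (d₃ : ℤ)) + (3 : ℤ)) % ((7 : ℕ) : ℤ) - (3 : ℤ)) ^ 2 + (((-(d₀ : ℤ) - 2 * (d₃ : ℤ)) + (3 : ℤ)) % ((7 : ℕ) : ℤ) - (3 : ℤ)) * (((-(d₁ : ℤ) - 2 * (d₂ : ℤ)) + (3 : ℤ)) % ((7 : ℕ) : ℤ) - (3 : ℤ)) - (((-(d₀ : ℤ) - 2 * (d₃ : ℤ)) + (3 : ℤ)) % ((7 : ℕ) : ℤ) - (3 : ℤ)) * ((((d₀ : ℤ) - 2 * (d₃ : ℤ)) + (3 : ℤ)) % ((7 : ℕ) : ℤ) - (3 : ℤ))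 + 2 * (((-(d₁ : ℤ) + 2 * (d₂ : ℤ)) + (3 : ℤ)) % ((7 : ℕ) : ℤ) - (3 : ℤ)) * (((-(d₁ : ℤ) - 2 * (d₂ : ℤ)) + (3 : ℤ)) % ((7 : ℕ) : ℤ) - (3 : ℤ)) + (((-(d₁ : ℤ) + 2 * (d₂ : ℤ)) + (3 : ℤ)) % ((7 : ℕ) : ℤ) - (3 : ℤ)) * ((((d₀ : ℤ) - 2 * (d₃ : ℤ)) + (3 : ℤ)) % ((7 : ℕ) : ℤ) - (3 : ℤ)) < ((7 : ℕ) : ℤ) ^ 2) ∨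
      (0 < (((-2 * (d₀ : ℤ) + 2 * (d₁ : ℤ) + 2 * (d₂ : ℤ) - 3 * (d₃ : ℤ)) + (3 : ℤ)) % ((7 : ℕ) : ℤ) - (3 : ℤ)) ^ 2 + 2 * (((-(d₀ : ℤ) - 2 * (d₁ : ℤ) + 3 * (d₂ : ℤ) + (d₃ : ℤ)) + (3 : ℤ)) % ((7 : ℕ) : ℤ) - (3 : ℤ)) ^ 2 + 4 * (((-2 * (d₁ : ℤ) - 4 * (d₂ : ℤ) - (d₃ : ℤ)) + (3 : ℤ)) % ((7 : ℕ) : ℤ) - (3 : ℤ)) ^ 2 + 2 * (((2 * (d₀ : ℤ) + 2 * (d₂ : ℤ) - 4 * (d₃ : ℤ)) + (3 : ℤ)) % ((7 : ℕ) : ℤ) - (3 : ℤ)) ^ 2 + (((-2 * (d₀ : ℤ) + 2 * (d₁ : ℤ) + 2 * (d₂ : ℤ) - 3 * (d₃ : ℤ)) + (3 : ℤ)) % ((7 : ℕ) : ℤ) - (3 : ℤ)) * (((-2 * (d₁ : ℤ) - 4 * (d₂ : ℤ) - (d₃ : ℤ)) + (3 : ℤ)) % ((7 : ℕ) : ℤ)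 - (3 : ℤ)) - (((-2 * (d₀ : ℤ) + 2 * (d₁ : ℤ) + 2 * (d₂ : ℤ) - 3 * (d₃ : ℤ)) + (3 : ℤ)) % ((7 : ℕ) : ℤ) - (3 : ℤ)) * (((2 * (d₀ : ℤ) + 2 * (d₂ : ℤ) - 4 * (d₃ : ℤ)) + (3 : ℤ)) % ((7 : ℕ) : ℤ) - (3 : ℤ)) + 2 * (((-(d₀ : ℤ) - 2 * (d₁ : ℤ) + 3 * (d₂ : ℤ) + (d₃ : ℤ)) + (3 : ℤ)) % ((7 : ℕ) : ℤ) - (3 : ℤ)) * (((-2 * (d₁ : ℤ) - 4 * (d₂ : ℤ) - (d₃ : ℤ)) + (3 : ℤ)) % ((7 : ℕ) : ℤ) - (3 : ℤ)) + (((-(d₀ : ℤ) - 2 * (d₁ : ℤ) + 3 * (d₂ : ℤ) + (d₃ : ℤ)) + (3 : ℤ)) % ((7 : ℕ) : ℤ) - (3 : ℤ)) * (((2 * (d₀ : ℤ) + 2 * (d₂ : ℤ) - 4 * (d₃ : ℤ)) + (3 : ℤ)) % ((7 : ℕ) : ℤ) - (3 : ℤ)) ∧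
        (((-2 * (d₀ : ℤ) + 2 * (d₁ : ℤ) + 2 * (d₂ : ℤ) - 3 * (d₃ : ℤ)) + (3 : ℤ)) % ((7 : ℕ) : ℤ) - (3 : ℤ)) ^ 2 + 2 * (((-(d₀ : ℤ) - 2 * (d₁ : ℤ) + 3 * (d₂ : ℤ) + (d₃ : ℤ)) + (3 : ℤ)) % ((7 : ℕ) : ℤ) - (3 : ℤ)) ^ 2 + 4 * (((-2 * (d₁ : ℤ) - 4 * (d₂ : ℤ) - (d₃ : ℤ)) + (3 : ℤ)) % ((7 : ℕ) : ℤ) - (3 : ℤ)) ^ 2 + 2 * (((2 * (d₀ : ℤ) + 2 * (d₂ : ℤ) - 4 * (d₃ : ℤ)) + (3 : ℤ)) % ((7 : ℕ) : ℤ) - (3 : ℤ)) ^ 2 + (((-2 * (d₀ : ℤ) + 2 * (d₁ : ℤ) + 2 * (d₂ : ℤ) - 3 * (d₃ : ℤ)) + (3 : ℤ)) % ((7 : ℕ) : ℤ) - (3 : ℤ)) * (((-2 * (d₁ : ℤ) - 4 * (d₂ : ℤ) - (d₃ : ℤ)) + (3 : ℤ)) % ((7 : ℕ) : ℤ) - (3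 : ℤ)) - (((-2 * (d₀ : ℤ) + 2 * (d₁ : ℤ) + 2 * (d₂ : ℤ) - 3 * (d₃ : ℤ)) + (3 : ℤ)) % ((7 : ℕ) : ℤ) - (3 : ℤ)) * (((2 * (d₀ : ℤ) + 2 * (d₂ : ℤ) - 4 * (d₃ : ℤ)) + (3 : ℤ)) % ((7 : ℕ) : ℤ) - (3 : ℤ)) + 2 * (((-(d₀ : ℤ) - 2 * (d₁ : ℤ) + 3 * (d₂ : ℤ) + (d₃ : ℤ)) + (3 : ℤ)) % ((7 : ℕ) : ℤ) - (3 : ℤ)) * (((-2 * (d₁ : ℤ) - 4 * (d₂ : ℤ) - (d₃ : ℤ)) + (3 : ℤ)) % ((7 : ℕ) : ℤ) - (3 : ℤ)) + (((-(d₀ : ℤ) - 2 * (d₁ : ℤ) + 3 * (d₂ : ℤ) + (d₃ : ℤ)) + (3 : ℤ)) % ((7 : ℕ) : ℤ) - (3 : ℤ)) * (((2 * (d₀ : ℤ) + 2 * (d₂ : ℤ) - 4 * (d₃ : ℤ)) + (3 : ℤ)) % ((7 : ℕ) : ℤ) - (3 : ℤ)) < ((7 : ℕ) : ℤ) ^ 2)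 ∨
      (0 < (((-(d₀ : ℤ) - 2 * (d₁ : ℤ) - 2 * (d₂ : ℤ) + (d₃ : ℤ)) + (3 : ℤ)) % ((7 : ℕ) : ℤ) - (3 : ℤ)) ^ 2 + 2 * ((((d₀ : ℤ) - (d₁ : ℤ) - (d₂ : ℤ) - (d₃ : ℤ)) + (3 : ℤ)) % ((7 : ℕ) : ℤ) - (3 : ℤ)) ^ 2 + 4 * ((((d₁ : ℤ) + (d₃ : ℤ)) + (3 : ℤ)) % ((7 : ℕ) : ℤ) - (3 : ℤ)) ^ 2 + 2 * (((-(d₀ : ℤ) - 2 * (d₂ : ℤ)) + (3 : ℤ)) % ((7 : ℕ) : ℤ) - (3 : ℤ)) ^ 2 + (((-(d₀ : ℤ) - 2 * (d₁ : ℤ) - 2 * (d₂ : ℤ) + (d₃ : ℤ)) + (3 : ℤ)) % ((7 : ℕ) : ℤ) - (3 : ℤ)) * ((((d₁ : ℤ) + (d₃ : ℤ)) + (3 : ℤ)) % ((7 : ℕ) : ℤ) - (3 : ℤ)) - (((-(d₀ : ℤ) - 2 * (d₁ : ℤ) - 2 * (d₂ : ℤ) + (d₃ : ℤ)) + (3 :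 ℤ)) % ((7 : ℕ) : ℤ) - (3 : ℤ)) * (((-(d₀ : ℤ) - 2 * (d₂ : ℤ)) + (3 : ℤ)) % ((7 : ℕ) : ℤ) - (3 : ℤ)) + 2 * ((((d₀ : ℤ) - (d₁ : ℤ) - (d₂ : ℤ) - (d₃ : ℤ)) + (3 : ℤ)) % ((7 : ℕ) : ℤ) - (3 : ℤ)) * ((((d₁ : ℤ) + (d₃ : ℤ)) + (3 : ℤ)) % ((7 : ℕ) : ℤ) - (3 : ℤ)) + ((((d₀ : ℤ) - (d₁ : ℤ) - (d₂ : ℤ) - (d₃ : ℤ)) + (3 : ℤ)) % ((7 : ℕ) : ℤ) - (3 : ℤ)) * (((-(d₀ : ℤ) - 2 * (d₂ : ℤ)) + (3 : ℤ)) % ((7 : ℕ) : ℤ) - (3 : ℤ)) ∧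
        (((-(d₀ : ℤ) - 2 * (d₁ : ℤ) - 2 * (d₂ : ℤ) + (d₃ : ℤ)) + (3 : ℤ)) % ((7 : ℕ) : ℤ) - (3 : ℤ)) ^ 2 + 2 * ((((d₀ : ℤ) - (d₁ : ℤ) - (d₂ : ℤ) - (d₃ : ℤ)) + (3 : ℤ)) % ((7 : ℕ) : ℤ) - (3 : ℤ)) ^ 2 + 4 * ((((d₁ : ℤ) + (d₃ : ℤ)) + (3 : ℤ)) % ((7 : ℕ) : ℤ) - (3 : ℤ)) ^ 2 + 2 * (((-(d₀ : ℤ) - 2 * (d₂ : ℤ)) + (3 : ℤ)) % ((7 : ℕ) : ℤ) - (3 : ℤ)) ^ 2 + (((-(d₀ : ℤ) - 2 * (d₁ : ℤ) - 2 * (d₂ : ℤ) + (d₃ : ℤ)) + (3 : ℤ)) % ((7 : ℕ) : ℤ) - (3 : ℤ)) * ((((d₁ : ℤ) + (d₃ : ℤ)) + (3 : ℤ)) % ((7 : ℕ) : ℤ) - (3 : ℤ)) - (((-(d₀ : ℤ) - 2 * (d₁ : ℤ) - 2 * (d₂ : ℤ) + (d₃ : ℤ)) + (3 : ℤ)) %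 ((7 : ℕ) : ℤ) - (3 : ℤ)) * (((-(d₀ : ℤ) - 2 * (d₂ : ℤ)) + (3 : ℤ)) % ((7 : ℕ) : ℤ) - (3 : ℤ)) + 2 * ((((d₀ : ℤ) - (d₁ : ℤ) - (d₂ : ℤ) - (d₃ : ℤ)) + (3 : ℤ)) % ((7 : ℕ) : ℤ) - (3 : ℤ)) * ((((d₁ : ℤ) + (d₃ : ℤ)) + (3 : ℤ)) % ((7 : ℕ) : ℤ) - (3 : ℤ)) + ((((d₀ : ℤ) - (d₁ : ℤ) - (d₂ : ℤ) - (d₃ : ℤ)) + (3 : ℤ)) % ((7 : ℕ) : ℤ) - (3 : ℤ)) * (((-(d₀ : ℤ) - 2 * (d₂ : ℤ)) + (3 : ℤ)) % ((7 : ℕ) : ℤ) - (3 : ℤ)) < ((7 : ℕ) : ℤ) ^ 2) ∨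
      (0 < (((2 * (d₁ : ℤ) + 2 * (d₂ : ℤ) - (d₃ : ℤ)) + (3 : ℤ)) % ((7 : ℕ) : ℤ) - (3 : ℤ)) ^ 2 + 2 * (((-(d₀ : ℤ) + (d₂ : ℤ) + (d₃ : ℤ)) + (3 : ℤ)) % ((7 : ℕ) : ℤ) - (3 : ℤ)) ^ 2 + 4 * (((-(d₁ : ℤ) - (d₂ : ℤ) - (d₃ : ℤ)) + (3 : ℤ)) % ((7 : ℕ) : ℤ) - (3 : ℤ)) ^ 2 + 2 * ((((d₀ : ℤ) + 2 * (d₂ : ℤ) - (d₃ : ℤ)) + (3 : ℤ)) % ((7 : ℕ) : ℤ) - (3 : ℤ)) ^ 2 + (((2 * (d₁ : ℤ) + 2 * (d₂ : ℤ) - (d₃ : ℤ)) + (3 : ℤ)) % ((7 : ℕ) : ℤ) - (3 : ℤ)) * (((-(d₁ : ℤ) - (d₂ : ℤ) - (d₃ : ℤ)) + (3 : ℤ)) % ((7 : ℕ) : ℤ) - (3 : ℤ)) - (((2 * (d₁ : ℤ) + 2 * (d₂ : ℤ) - (d₃ : ℤ)) + (3 : ℤ)) % ((7 : ℕ) : ℤ)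 - (3 : ℤ)) * ((((d₀ : ℤ) + 2 * (d₂ : ℤ) - (d₃ : ℤ)) + (3 : ℤ)) % ((7 : ℕ) : ℤ) - (3 : ℤ)) + 2 * (((-(d₀ : ℤ) + (d₂ : ℤ) + (d₃ : ℤ)) + (3 : ℤ)) % ((7 : ℕ) : ℤ) - (3 : ℤ)) * (((-(d₁ : ℤ) - (d₂ : ℤ) - (d₃ : ℤ)) + (3 : ℤ)) % ((7 : ℕ) : ℤ) - (3 : ℤ)) + (((-(d₀ : ℤ) + (d₂ : ℤ) + (d₃ : ℤ)) + (3 : ℤ)) % ((7 : ℕ) : ℤ) - (3 : ℤ)) * ((((d₀ : ℤ) + 2 * (d₂ : ℤ) - (d₃ : ℤ)) + (3 : ℤ)) % ((7 : ℕ) : ℤ) - (3 : ℤ)) ∧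
        (((2 * (d₁ : ℤ) + 2 * (d₂ : ℤ) - (d₃ : ℤ)) + (3 : ℤ)) % ((7 : ℕ) : ℤ) - (3 : ℤ)) ^ 2 + 2 * (((-(d₀ : ℤ) + (d₂ : ℤ) + (d₃ : ℤ)) + (3 : ℤ)) % ((7 : ℕ) : ℤ) - (3 : ℤ)) ^ 2 + 4 * (((-(d₁ : ℤ) - (d₂ : ℤ) - (d₃ : ℤ)) + (3 : ℤ)) % ((7 : ℕ) : ℤ) - (3 : ℤ)) ^ 2 + 2 * ((((d₀ : ℤ) + 2 * (d₂ : ℤ) - (d₃ : ℤ)) + (3 : ℤ)) % ((7 : ℕ) : ℤ) - (3 : ℤ)) ^ 2 + (((2 * (d₁ : ℤ) + 2 * (d₂ : ℤ) - (d₃ : ℤ)) + (3 : ℤ)) % ((7 : ℕ) : ℤ) - (3 : ℤ)) * (((-(d₁ : ℤ) - (d₂ : ℤ) - (d₃ : ℤ)) + (3 : ℤ)) % ((7 : ℕ) : ℤ) - (3 : ℤ)) - (((2 * (d₁ : ℤ) + 2 * (d₂ : ℤ) - (d₃ : ℤ)) + (3 : ℤ)) % ((7 : ℕ) : ℤ)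 - (3 : ℤ)) * ((((d₀ : ℤ) + 2 * (d₂ : ℤ) - (d₃ : ℤ)) + (3 : ℤ)) % ((7 : ℕ) : ℤ) - (3 : ℤ)) + 2 * (((-(d₀ : ℤ) + (d₂ : ℤ) + (d₃ : ℤ)) + (3 : ℤ)) % ((7 : ℕ) : ℤ) - (3 : ℤ)) * (((-(d₁ : ℤ) - (d₂ : ℤ) - (d₃ : ℤ)) + (3 : ℤ)) % ((7 : ℕ) : ℤ) - (3 : ℤ)) + (((-(d₀ : ℤ) + (d₂ : ℤ) + (d₃ : ℤ)) + (3 : ℤ)) % ((7 : ℕ) : ℤ) - (3 : ℤ)) * ((((d₀ : ℤ) + 2 * (d₂ : ℤ) - (d₃ : ℤ)) + (3 : ℤ)) % ((7 : ℕ) : ℤ) - (3 : ℤ)) < ((7 : ℕ) : ℤ) ^ 2) := by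
  decide +kernel

/-- **Soundness of the certificates**: the disjunction of `cert_p` at the residues `(d₀, d₁, d₂, d₃)` yields multipliers for
`δ = d₀ + d₁i + d₂α + d₃η`. [cite: CardosoMachiavelo2025, Prop. 3 and Thm. 7] -/
private theorem cert_sound (p : ℕ) (hp : 0 < p) (h : ℤ) (d₀ d₁ d₂ d₃ : ℕ)
    (H : (0 < (((-(d₀ : ℤ)) + h) % (p : ℤ) - h) ^ 2 + 2 * (((-(d₁ : ℤ)) + h) % (p : ℤ) - h) ^ 2 + 4 * (((-(d₂ : ℤ)) + h) % (p : ℤ) - h) ^ 2 + 2 * (((-(d₃ : ℤ)) + h) % (p : ℤ) - h) ^ 2 + (((-(d₀ : ℤ)) + h) % (p : ℤ) - h) * (((-(d₂ : ℤ)) + h) % (p : ℤ) - h) - (((-(d₀ : ℤ)) + h) % (p : ℤ) - h) * (((-(d₃ : ℤ)) + h) % (p : ℤ) - h) + 2 * (((-(d₁ : ℤ)) + h) % (p : ℤ) - h) * (((-(d₂ : ℤ)) + h) % (p : ℤ) - h) + (((-(d₁ : ℤ)) + h) % (p : ℤ) - h) * (((-(d₃ : ℤ)) + h) % (p : ℤ)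 - h) ∧
        (((-(d₀ : ℤ)) + h) % (p : ℤ) - h) ^ 2 + 2 * (((-(d₁ : ℤ)) + h) % (p : ℤ) - h) ^ 2 + 4 * (((-(d₂ : ℤ)) + h) % (p : ℤ) - h) ^ 2 + 2 * (((-(d₃ : ℤ)) + h) % (p : ℤ) - h) ^ 2 + (((-(d₀ : ℤ)) + h) % (p : ℤ) - h) * (((-(d₂ : ℤ)) + h) % (p : ℤ) - h) - (((-(d₀ : ℤ)) + h) % (p : ℤ) - h) * (((-(d₃ : ℤ)) + h) % (p : ℤ) - h) + 2 * (((-(d₁ : ℤ)) + h) % (p : ℤ) - h) * (((-(d₂ : ℤ)) + h) % (p : ℤ) - h) + (((-(d₁ : ℤ)) + h) % (p : ℤ) - h) * (((-(d₃ : ℤ)) + h) % (p : ℤ) - h) < (p : ℤ) ^ 2) ∨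
      (0 < (((-(d₀ : ℤ) - 2 * (d₃ : ℤ)) + h) % (p : ℤ) - h) ^ 2 + 2 * (((-(d₁ : ℤ) + 2 * (d₂ : ℤ)) + h) % (p : ℤ) - h) ^ 2 + 4 * (((-(d₁ : ℤ) - 2 * (d₂ : ℤ)) + h) % (p : ℤ) - h) ^ 2 + 2 * ((((d₀ : ℤ) - 2 * (d₃ : ℤ)) + h) % (p : ℤ) - h) ^ 2 + (((-(d₀ : ℤ) - 2 * (d₃ : ℤ)) + h) % (p : ℤ) - h) * (((-(d₁ : ℤ) - 2 * (d₂ : ℤ)) + h) % (p : ℤ) - h) - (((-(d₀ : ℤ) - 2 * (d₃ : ℤ)) + h) % (p : ℤ) - h) * ((((d₀ : ℤ) - 2 * (d₃ : ℤ)) + h) % (p : ℤ) - h) + 2 * (((-(d₁ : ℤ) + 2 * (d₂ : ℤ)) + h) % (p : ℤ) - h) * (((-(d₁ : ℤ) - 2 * (d₂ : ℤ)) + h) % (p : ℤ) - h) + (((-(d₁ : ℤ) + 2 * (d₂ : ℤ)) + h) % (p : ℤ) - h) * ((((d₀ : ℤ) - 2 * (d₃ : ℤ)) + h) % (p : ℤ)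 - h) ∧
        (((-(d₀ : ℤ) - 2 * (d₃ : ℤ)) + h) % (p : ℤ) - h) ^ 2 + 2 * (((-(d₁ : ℤ) + 2 * (d₂ : ℤ)) + h) % (p : ℤ) - h) ^ 2 + 4 * (((-(d₁ : ℤ) - 2 * (d₂ : ℤ)) + h) % (p : ℤ) - h) ^ 2 + 2 * ((((d₀ : ℤ) - 2 * (d₃ : ℤ)) + h) % (p : ℤ) - h) ^ 2 + (((-(d₀ : ℤ) - 2 * (d₃ : ℤ)) + h) % (p : ℤ) - h) * (((-(d₁ : ℤ) - 2 * (d₂ : ℤ)) + h) % (p : ℤ) - h) - (((-(d₀ : ℤ) - 2 * (d₃ : ℤ)) + h) % (p : ℤ) - h) * ((((d₀ : ℤ) - 2 * (d₃ : ℤ)) + h) % (p : ℤ) - h) + 2 * (((-(d₁ : ℤ) + 2 * (d₂ : ℤ)) + h) % (p : ℤ) - h) * (((-(d₁ : ℤ) - 2 * (d₂ : ℤ)) + h) % (p : ℤ) - h) + (((-(d₁ : ℤ) + 2 * (d₂ : ℤ)) + h) % (p : ℤ) - h) * ((((d₀ : ℤ) - 2 * (d₃ : ℤ)) + h) % (p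 : ℤ) - h) < (p : ℤ) ^ 2) ∨
      (0 < (((-2 * (d₀ : ℤ) + 2 * (d₁ : ℤ) + 2 * (d₂ : ℤ) - 3 * (d₃ : ℤ)) + h) % (p : ℤ) - h) ^ 2 + 2 * (((-(d₀ : ℤ) - 2 * (d₁ : ℤ) + 3 * (d₂ : ℤ) + (d₃ : ℤ)) + h) % (p : ℤ) - h) ^ 2 + 4 * (((-2 * (d₁ : ℤ) - 4 * (d₂ : ℤ) - (d₃ : ℤ)) + h) % (p : ℤ) - h) ^ 2 + 2 * (((2 * (d₀ : ℤ) + 2 * (d₂ : ℤ) - 4 * (d₃ : ℤ)) + h) % (p : ℤ) - h) ^ 2 + (((-2 * (d₀ : ℤ) + 2 * (d₁ : ℤ) + 2 * (d₂ : ℤ) - 3 * (d₃ : ℤ)) + h) % (p : ℤ) - h) * (((-2 * (d₁ : ℤ) - 4 * (d₂ : ℤ) - (d₃ : ℤ)) + h) % (p : ℤ) - h) - (((-2 * (d₀ : ℤ) + 2 * (d₁ : ℤ) + 2 * (d₂ : ℤ) - 3 * (d₃ : ℤ)) + h) % (p : ℤ) - h) * (((2 * (d₀ : ℤ) + 2 *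 (d₂ : ℤ) - 4 * (d₃ : ℤ)) + h) % (p : ℤ) - h) + 2 * (((-(d₀ : ℤ) - 2 * (d₁ : ℤ) + 3 * (d₂ : ℤ) + (d₃ : ℤ)) + h) % (p : ℤ) - h) * (((-2 * (d₁ : ℤ) - 4 * (d₂ : ℤ) - (d₃ : ℤ)) + h) % (p : ℤ) - h) + (((-(d₀ : ℤ) - 2 * (d₁ : ℤ) + 3 * (d₂ : ℤ) + (d₃ : ℤ)) + h) % (p : ℤ) - h) * (((2 * (d₀ : ℤ) + 2 * (d₂ : ℤ) - 4 * (d₃ : ℤ)) + h) % (p : ℤ) - h) ∧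
        (((-2 * (d₀ : ℤ) + 2 * (d₁ : ℤ) + 2 * (d₂ : ℤ) - 3 * (d₃ : ℤ)) + h) % (p : ℤ) - h) ^ 2 + 2 * (((-(d₀ : ℤ) - 2 * (d₁ : ℤ) + 3 * (d₂ : ℤ) + (d₃ : ℤ)) + h) % (p : ℤ) - h) ^ 2 + 4 * (((-2 * (d₁ : ℤ) - 4 * (d₂ : ℤ) - (d₃ : ℤ)) + h) % (p : ℤ) - h) ^ 2 + 2 * (((2 * (d₀ : ℤ) + 2 * (d₂ : ℤ) - 4 * (d₃ : ℤ)) + h) % (p : ℤ) - h) ^ 2 + (((-2 * (d₀ : ℤ) + 2 * (d₁ : ℤ) + 2 * (d₂ : ℤ) - 3 * (d₃ : ℤ)) + h) % (p : ℤ) - h) * (((-2 * (d₁ : ℤ) - 4 * (d₂ : ℤ) - (d₃ : ℤ)) + h) % (p : ℤ) - h) - (((-2 * (d₀ : ℤ) + 2 * (d₁ : ℤ) + 2 * (d₂ : ℤ) - 3 * (d₃ : ℤ)) + h) % (p : ℤ) - h) * (((2 * (d₀ : ℤ) + 2 * (d₂ : ℤ) - 4 * (d₃ : ℤ)) + h)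 % (p : ℤ) - h) + 2 * (((-(d₀ : ℤ) - 2 * (d₁ : ℤ) + 3 * (d₂ : ℤ) + (d₃ : ℤ)) + h) % (p : ℤ) - h) * (((-2 * (d₁ : ℤ) - 4 * (d₂ : ℤ) - (d₃ : ℤ)) + h) % (p : ℤ) - h) + (((-(d₀ : ℤ) - 2 * (d₁ : ℤ) + 3 * (d₂ : ℤ) + (d₃ : ℤ)) + h) % (p : ℤ) - h) * (((2 * (d₀ : ℤ) + 2 * (d₂ : ℤ) - 4 * (d₃ : ℤ)) + h) % (p : ℤ) - h) < (p : ℤ) ^ 2) ∨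
      (0 < (((-(d₀ : ℤ) - 2 * (d₁ : ℤ) - 2 * (d₂ : ℤ) + (d₃ : ℤ)) + h) % (p : ℤ) - h) ^ 2 + 2 * ((((d₀ : ℤ) - (d₁ : ℤ) - (d₂ : ℤ) - (d₃ : ℤ)) + h) % (p : ℤ) - h) ^ 2 + 4 * ((((d₁ : ℤ) + (d₃ : ℤ)) + h) % (p : ℤ) - h) ^ 2 + 2 * (((-(d₀ : ℤ) - 2 * (d₂ : ℤ)) + h) % (p : ℤ) - h) ^ 2 + (((-(d₀ : ℤ) - 2 * (d₁ : ℤ) - 2 * (d₂ : ℤ) + (d₃ : ℤ)) + h) % (p : ℤ) - h) * ((((d₁ : ℤ) + (d₃ : ℤ)) + h) % (p : ℤ) - h) - (((-(d₀ : ℤ) - 2 * (d₁ : ℤ) - 2 * (d₂ : ℤ) + (d₃ : ℤ)) + h) % (p : ℤ) - h) * (((-(d₀ : ℤ) - 2 * (d₂ : ℤ)) + h) % (p : ℤ) - h) + 2 * ((((d₀ : ℤ) - (d₁ : ℤ) - (d₂ : ℤ) - (d₃ : ℤ)) + h) % (p : ℤ) - h) * ((((d₁ : ℤ) + (d₃ :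 ℤ)) + h) % (p : ℤ) - h) + ((((d₀ : ℤ) - (d₁ : ℤ) - (d₂ : ℤ) - (d₃ : ℤ)) + h) % (p : ℤ) - h) * (((-(d₀ : ℤ) - 2 * (d₂ : ℤ)) + h) % (p : ℤ) - h) ∧
        (((-(d₀ : ℤ) - 2 * (d₁ : ℤ) - 2 * (d₂ : ℤ) + (d₃ : ℤ)) + h) % (p : ℤ) - h) ^ 2 + 2 * ((((d₀ : ℤ) - (d₁ : ℤ) - (d₂ : ℤ) - (d₃ : ℤ)) + h) % (p : ℤ) - h) ^ 2 + 4 * ((((d₁ : ℤ) + (d₃ : ℤ)) + h) % (p : ℤ) - h) ^ 2 + 2 * (((-(d₀ : ℤ) - 2 * (d₂ : ℤ)) + h) % (p : ℤ) - h) ^ 2 + (((-(d₀ : ℤ) - 2 * (d₁ : ℤ) - 2 * (d₂ : ℤ) + (d₃ : ℤ)) + h) % (p : ℤ) - h) * ((((d₁ : ℤ) + (d₃ : ℤ)) + h) % (p : ℤ) - h) - (((-(d₀ : ℤ) - 2 * (d₁ : ℤ) - 2 * (d₂ : ℤ) + (d₃ : ℤ)) + h) % (p : ℤ) - h) * (((-(d₀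 : ℤ) - 2 * (d₂ : ℤ)) + h) % (p : ℤ) - h) + 2 * ((((d₀ : ℤ) - (d₁ : ℤ) - (d₂ : ℤ) - (d₃ : ℤ)) + h) % (p : ℤ) - h) * ((((d₁ : ℤ) + (d₃ : ℤ)) + h) % (p : ℤ) - h) + ((((d₀ : ℤ) - (d₁ : ℤ) - (d₂ : ℤ) - (d₃ : ℤ)) + h) % (p : ℤ) - h) * (((-(d₀ : ℤ) - 2 * (d₂ : ℤ)) + h) % (p : ℤ) - h) < (p : ℤ) ^ 2) ∨
      (0 < (((2 * (d₁ : ℤ) + 2 * (d₂ : ℤ) - (d₃ : ℤ)) + h) % (p : ℤ) - h) ^ 2 + 2 * (((-(d₀ : ℤ) + (d₂ : ℤ) + (d₃ : ℤ)) + h) % (p : ℤ) - h) ^ 2 + 4 * (((-(d₁ : ℤ) - (d₂ : ℤ) - (d₃ : ℤ)) + h) % (p : ℤ) - h) ^ 2 + 2 * ((((d₀ : ℤ) + 2 * (d₂ : ℤ) - (d₃ : ℤ)) + h) % (p : ℤ) - h) ^ 2 + (((2 * (d₁ : ℤ) + 2 * (d₂ : ℤ) - (d₃ : ℤ)) + h)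 % (p : ℤ) - h) * (((-(d₁ : ℤ) - (d₂ : ℤ) - (d₃ : ℤ)) + h) % (p : ℤ) - h) - (((2 * (d₁ : ℤ) + 2 * (d₂ : ℤ) - (d₃ : ℤ)) + h) % (p : ℤ) - h) * ((((d₀ : ℤ) + 2 * (d₂ : ℤ) - (d₃ : ℤ)) + h) % (p : ℤ) - h) + 2 * (((-(d₀ : ℤ) + (d₂ : ℤ) + (d₃ : ℤ)) + h) % (p : ℤ) - h) * (((-(d₁ : ℤ) - (d₂ : ℤ) - (d₃ : ℤ)) + h) % (p : ℤ) - h) + (((-(d₀ : ℤ) + (d₂ : ℤ) + (d₃ : ℤ)) + h) % (p : ℤ) - h) * ((((d₀ : ℤ) + 2 * (d₂ : ℤ) - (d₃ : ℤ)) + h) % (p : ℤ) - h) ∧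
        (((2 * (d₁ : ℤ) + 2 * (d₂ : ℤ) - (d₃ : ℤ)) + h) % (p : ℤ) - h) ^ 2 + 2 * (((-(d₀ : ℤ) + (d₂ : ℤ) + (d₃ : ℤ)) + h) % (p : ℤ) - h) ^ 2 + 4 * (((-(d₁ : ℤ) - (d₂ : ℤ) - (d₃ : ℤ)) + h) % (p : ℤ) - h) ^ 2 + 2 * ((((d₀ : ℤ) + 2 * (d₂ : ℤ) - (d₃ : ℤ)) + h) % (p : ℤ) - h) ^ 2 + (((2 * (d₁ : ℤ) + 2 * (d₂ : ℤ) - (d₃ : ℤ)) + h) % (p : ℤ) - h) * (((-(d₁ : ℤ) - (d₂ : ℤ) - (d₃ : ℤ)) + h) % (p : ℤ) - h) - (((2 * (d₁ : ℤ) + 2 * (d₂ : ℤ) - (d₃ : ℤ)) + h) % (p : ℤ) - h) * ((((d₀ : ℤ) + 2 * (d₂ : ℤ) - (d₃ : ℤ)) + h) % (p : ℤ) - h) + 2 * (((-(d₀ : ℤ) + (d₂ : ℤ) + (d₃ : ℤ)) + h) % (p : ℤ) - h) * (((-(d₁ : ℤ) - (d₂ : ℤ) - (d₃ : ℤ)) +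 h) % (p : ℤ) - h) + (((-(d₀ : ℤ) + (d₂ : ℤ) + (d₃ : ℤ)) + h) % (p : ℤ) - h) * ((((d₀ : ℤ) + 2 * (d₂ : ℤ) - (d₃ : ℤ)) + h) % (p : ℤ) - h) < (p : ℤ) ^ 2)) :
    ∃ γ ∈ (Submodule.span ℤ (Set.range ![(⟨1, 0, 0, 0⟩ : ℍ[ℚ,-2,-13]), ⟨0, 1, 0, 0⟩, ⟨1/2, 1/2, 1/2, 0⟩, ⟨-1/2, 1/4, 0, 1/4⟩])), ∃ β ∈ (Submodule.span ℤ (Set.range ![(⟨1, 0, 0, 0⟩ : ℍ[ℚ,-2,-13]), ⟨0, 1, 0, 0⟩, ⟨1/2, 1/2, 1/2, 0⟩, ⟨-1/2, 1/4, 0, 1/4⟩])),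
      0 < reducedNorm ℚ ℍ[ℚ,-2,-13] (((p : ℚ)⁻¹ • (⟨((d₀ : ℤ) : ℚ) + ((d₂ : ℤ) : ℚ) / 2 - ((d₃ : ℤ) : ℚ) / 2,
          ((d₁ : ℤ) : ℚ) + ((d₂ : ℤ) : ℚ) / 2 + ((d₃ : ℤ) : ℚ) / 4, ((d₂ : ℤ) : ℚ) / 2, ((d₃ : ℤ) : ℚ) / 4⟩ : ℍ[ℚ,-2,-13])) * γ - β) ∧
        reducedNorm ℚ ℍ[ℚ,-2,-13] (((p : ℚ)⁻¹ • (⟨((d₀ : ℤ) : ℚ) + ((d₂ : ℤ) : ℚ) / 2 - ((d₃ : ℤ) : ℚ) / 2,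
          ((d₁ : ℤ) : ℚ) + ((d₂ : ℤ) : ℚ) / 2 + ((d₃ : ℤ) : ℚ) / 4, ((d₂ : ℤ) : ℚ) / 2, ((d₃ : ℤ) : ℚ) / 4⟩ : ℍ[ℚ,-2,-13])) * γ - β) < 1 := by
  rcases H with ⟨h1, h2⟩ | ⟨h1, h2⟩ | ⟨h1, h2⟩ | ⟨h1, h2⟩ | ⟨h1, h2⟩
  · exact ⟨_, mk_mem_lattice (-1) (0) (0) (0), exists_beta hp (mk_mem_lattice (-1) (0) (0) (0)) (mk_mul_negOne _ _ _ _)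
      (centred_modEq _ h _) (centred_modEq _ h _) (centred_modEq _ h _) (centred_modEq _ h _) h1 h2⟩
  · exact ⟨_, mk_mem_lattice (-1) (0) (0) (1), exists_beta hp (mk_mem_lattice (-1) (0) (0) (1)) (mk_mul_etaSubOne _ _ _ _)
      (centred_modEq _ h _) (centred_modEq _ h _) (centred_modEq _ h _) (centred_modEq _ h _) h1 h2⟩
  · exact ⟨_, mk_mem_lattice (-2) (-1) (0) (2), exists_beta hp (mk_mem_lattice (-2) (-1) (0) (2)) (mk_mul_w3 _ _ _ _)
      (centred_modEq _ h _) (centred_modEq _ h _) (centred_modEq _ h _) (centred_modEq _ h _) h1 h2⟩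
  · exact ⟨_, mk_mem_lattice (-1) (1) (0) (-1), exists_beta hp (mk_mem_lattice (-1) (1) (0) (-1)) (mk_mul_w4 _ _ _ _)
      (centred_modEq _ h _) (centred_modEq _ h _) (centred_modEq _ h _) (centred_modEq _ h _) h1 h2⟩
  · exact ⟨_, mk_mem_lattice (0) (-1) (0) (1), exists_beta hp (mk_mem_lattice (0) (-1) (0) (1)) (mk_mul_w5 _ _ _ _)
      (centred_modEq _ h _) (centred_modEq _ h _) (centred_modEq _ h _) (centred_modEq _ h _) h1 h2⟩

/-- **Every `δ ∈ O₁₃` with `δ/p ∉ O₁₃`, `p ≤ 7` prime, admits `γ, β ∈ O₁₃` with `0 < nrd((δ/p)γ − β) < 1`** (reduce the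
coordinates of `δ` mod `p` and apply the certificate). [cite: CardosoMachiavelo2025, Thm. 4, Thm. 7 and §5.2 Thm. 9] -/
theorem exists_alpha_beta_of_prime_le {p : ℕ} (hp : p.Prime) (hle : p ≤ 7) {x : ℍ[ℚ,-2,-13]} (hx : x ∈ (Submodule.span ℤ (Set.range ![(⟨1, 0, 0, 0⟩ : ℍ[ℚ,-2,-13]), ⟨0, 1, 0, 0⟩, ⟨1/2, 1/2, 1/2, 0⟩, ⟨-1/2, 1/4, 0, 1/4⟩])))
    (hnot : (p : ℚ)⁻¹ • x ∉ (Submodule.span ℤ (Set.range ![(⟨1, 0, 0, 0⟩ : ℍ[ℚ,-2,-13]), ⟨0, 1, 0, 0⟩, ⟨1/2, 1/2, 1/2, 0⟩, ⟨-1/2, 1/4, 0, 1/4⟩]))) :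
    ∃ γ ∈ (Submodule.span ℤ (Set.range ![(⟨1, 0, 0, 0⟩ : ℍ[ℚ,-2,-13]), ⟨0, 1, 0, 0⟩, ⟨1/2, 1/2, 1/2, 0⟩, ⟨-1/2, 1/4, 0, 1/4⟩])), ∃ β ∈ (Submodule.span ℤ (Set.range ![(⟨1, 0, 0, 0⟩ : ℍ[ℚ,-2,-13]), ⟨0, 1, 0, 0⟩, ⟨1/2, 1/2, 1/2, 0⟩, ⟨-1/2, 1/4, 0, 1/4⟩])),
      0 < reducedNorm ℚ ℍ[ℚ,-2,-13] (((p : ℚ)⁻¹ • x) * γ - β) ∧ reducedNorm ℚ ℍ[ℚ,-2,-13] (((p : ℚ)⁻¹ • x) * γ - β) < 1 := by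
  have hp0 : 0 < p := hp.pos
  have hpz : (0 : ℤ) < p := by exact_mod_cast hp0
  have hp' : (p : ℚ) ≠ 0 := by exact_mod_cast hp0.ne'
  obtain ⟨X₀, X₁, X₂, X₃, rfl⟩ := (mem_lattice_iff x).1 hx
  obtain ⟨d₀, hd₀, hd₀p⟩ : ∃ d : ℕ, (d : ℤ) = X₀ % p ∧ d < p :=
    ⟨(X₀ % p).toNat, Int.toNat_of_nonneg (Int.emod_nonneg _ hpz.ne'),
      by have := Int.emod_lt_of_pos X₀ hpz; omega⟩
  obtain ⟨d₁, hd₁, hd₁p⟩ : ∃ d : ℕ, (d : ℤ) = X₁ % p ∧ d < p :=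
    ⟨(X₁ % p).toNat, Int.toNat_of_nonneg (Int.emod_nonneg _ hpz.ne'),
      by have := Int.emod_lt_of_pos X₁ hpz; omega⟩
  obtain ⟨d₂, hd₂, hd₂p⟩ : ∃ d : ℕ, (d : ℤ) = X₂ % p ∧ d < p :=
    ⟨(X₂ % p).toNat, Int.toNat_of_nonneg (Int.emod_nonneg _ hpz.ne'),
      by have := Int.emod_lt_of_pos X₂ hpz; omega⟩
  obtain ⟨d₃, hd₃, hd₃p⟩ : ∃ d : ℕ, (d : ℤ) = X₃ % p ∧ d < p :=
    ⟨(X₃ % p).toNat, Int.toNat_of_nonneg (Int.emod_nonneg _ hpz.ne'),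
      by have := Int.emod_lt_of_pos X₃ hpz; omega⟩
  have e₀ : X₀ = (d₀ : ℤ) + p * (X₀ / p) := by rw [hd₀]; linarith [Int.emod_add_mul_ediv X₀ (p : ℤ)]
  have e₁ : X₁ = (d₁ : ℤ) + p * (X₁ / p) := by rw [hd₁]; linarith [Int.emod_add_mul_ediv X₁ (p : ℤ)]
  have e₂ : X₂ = (d₂ : ℤ) + p * (X₂ / p) := by rw [hd₂]; linarith [Int.emod_add_mul_ediv X₂ (p : ℤ)]
  have e₃ : X₃ = (d₃ : ℤ) + p * (X₃ / p) := by rw [hd₃]; linarith [Int.emod_add_mul_ediv X₃ (p : ℤ)]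
  have e : (⟨(X₀ : ℚ) + (X₂ : ℚ) / 2 - (X₃ : ℚ) / 2, (X₁ : ℚ) + (X₂ : ℚ) / 2 + (X₃ : ℚ) / 4, (X₂ : ℚ) / 2, (X₃ : ℚ) / 4⟩ : ℍ[ℚ,-2,-13]) =
      ⟨((d₀ : ℤ) : ℚ) + ((d₂ : ℤ) : ℚ) / 2 - ((d₃ : ℤ) : ℚ) / 2, ((d₁ : ℤ) : ℚ) + ((d₂ : ℤ) : ℚ) / 2 + ((d₃ : ℤ) : ℚ) / 4,
          ((d₂ : ℤ) : ℚ) / 2, ((d₃ : ℤ) : ℚ) / 4⟩ +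
        (p : ℚ) • ⟨((X₀ / p : ℤ) : ℚ) + ((X₂ / p : ℤ) : ℚ) / 2 - ((X₃ / p : ℤ) : ℚ) / 2,
          ((X₁ / p : ℤ) : ℚ) + ((X₂ / p : ℤ) : ℚ) / 2 + ((X₃ / p : ℤ) : ℚ) / 4, ((X₂ / p : ℤ) : ℚ) / 2, ((X₃ / p : ℤ) : ℚ) / 4⟩ := by
    have hn : ((p : ℤ) : ℚ) = (p : ℚ) := by push_cast; rfl
    rw [← hn, mk_add_smul_mk, ← e₀, ← e₁, ← e₂, ← e₃]
  have hne : d₀ ≠ 0 ∨ d₁ ≠ 0 ∨ d₂ ≠ 0 ∨ d₃ ≠ 0 := by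
    by_contra hcon
    push Not at hcon
    obtain ⟨z₀, z₁, z₂, z₃⟩ := hcon
    apply hnot
    rw [e, z₀, z₁, z₂, z₃, smul_add, smul_smul, inv_mul_cancel₀ hp', one_smul]
    have hz : ((p : ℚ)⁻¹ • (⟨(((0 : ℕ) : ℤ) : ℚ) + (((0 : ℕ) : ℤ) : ℚ) / 2 - (((0 : ℕ) : ℤ) : ℚ) / 2,
        (((0 : ℕ) : ℤ) : ℚ) + (((0 : ℕ) : ℤ) : ℚ) / 2 + (((0 : ℕ) : ℤ) : ℚ) / 4, (((0 : ℕ) : ℤ) : ℚ) / 2,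
        (((0 : ℕ) : ℤ) : ℚ) / 4⟩ : ℍ[ℚ,-2,-13])) = 0 := by
      ext <;> simp
    rw [hz, zero_add]
    exact mk_mem_lattice _ _ _ _
  refine exists_of_add_smul hp0 (mk_mem_lattice _ _ _ _) e ?_
  have h2 := hp.two_le
  interval_cases p
  · exact cert_sound 2 hp0 0 d₀ d₁ d₂ d₃ (cert_2 d₀ hd₀p d₁ hd₁p d₂ hd₂p d₃ hd₃p hne)
  · exact cert_sound 3 hp0 1 d₀ d₁ d₂ d₃ (cert_3 d₀ hd₀p d₁ hd₁p d₂ hd₂p d₃ hd₃p hne)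
  · exact absurd hp (by decide)
  · exact cert_sound 5 hp0 2 d₀ d₁ d₂ d₃ (cert_5 d₀ hd₀p d₁ hd₁p d₂ hd₂p d₃ hd₃p hne)
  · exact absurd hp (by decide)
  · exact cert_sound 7 hp0 3 d₀ d₁ d₂ d₃ (cert_7 d₀ hd₀p d₁ hd₁p d₂ hd₂p d₃ hd₃p hne)

end Certificates

/-! ## §3 The primes `p ≥ 11`: Minkowski's convex body theorem -/

section LargePrimes

/-- A real square root of the norm form: with `B = (1, 0, ½, −½; 0, √2, √2/2, √2/4; 0, 0, √13/2, 0; 0, 0, 0, √26/4)` one has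
`Σᵢ (B w)ᵢ² = Q₁₃(w) = w₀² + 2w₁² + 4w₂² + 2w₃² + w₀w₂ − w₀w₃ + 2w₁w₂ + w₁w₃` (`Q₁₃ = (a + c/2 − d/2)² + 2(b + c/2 + d/4)² + 13c²/4 + 26d²/16`).
[cite: HardyWright2008, §24.2 (before Thm. 452)] -/
theorem sum_sq_sqrtMatrix_mulVec (w : Fin 4 → ℝ) :
    ∑ i, (!![(1 : ℝ), 0, 1/2, -1/2; 0, Real.sqrt 2, Real.sqrt 2 / 2, Real.sqrt 2 / 4; 0, 0, Real.sqrt 13 / 2, 0;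
        0, 0, 0, Real.sqrt 26 / 4] : Matrix (Fin 4) (Fin 4) ℝ).mulVec w i ^ 2 =
      w 0 ^ 2 + 2 * w 1 ^ 2 + 4 * w 2 ^ 2 + 2 * w 3 ^ 2 + w 0 * w 2 - w 0 * w 3 + 2 * w 1 * w 2 + w 1 * w 3 := by
  have h2 : Real.sqrt 2 ^ 2 = 2 := Real.sq_sqrt (by norm_num)
  have h13 : Real.sqrt 13 ^ 2 = 13 := Real.sq_sqrt (by norm_num)
  have h26 : Real.sqrt 26 ^ 2 = 26 := Real.sq_sqrt (by norm_num)
  simp only [Matrix.mulVec, dotProduct, Fin.sum_univ_four, Matrix.of_apply, Matrix.cons_val', Matrix.cons_val_zero,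
    Matrix.cons_val_one, Matrix.cons_val, Matrix.empty_val', Matrix.cons_val_fin_one]
  linear_combination (w 1 + w 2 / 2 + w 3 / 4) ^ 2 * h2 + (w 2 / 2) ^ 2 * h13 + (w 3 / 4) ^ 2 * h26

/-- `det B = 1 · √2 · (√13/2) · (√26/4) = 13/4` (upper triangular; `√2·√13·√26 = 26`). [cite: HardyWright2008, §24.2] -/
theorem det_sqrtMatrix :
    (!![(1 : ℝ), 0, 1/2, -1/2; 0, Real.sqrt 2, Real.sqrt 2 / 2, Real.sqrt 2 / 4; 0, 0, Real.sqrt 13 / 2, 0;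
        0, 0, 0, Real.sqrt 26 / 4] : Matrix (Fin 4) (Fin 4) ℝ).det = 13 / 4 := by
  rw [Matrix.det_of_upperTriangular]
  · simp only [Fin.prod_univ_four, Matrix.of_apply, Matrix.cons_val', Matrix.cons_val_zero, Matrix.cons_val_one,
      Matrix.cons_val, Matrix.empty_val', Matrix.cons_val_fin_one]
    have h : Real.sqrt 2 * Real.sqrt 13 = Real.sqrt 26 := by
      rw [← Real.sqrt_mul (by norm_num)]; norm_num
    have h26 : Real.sqrt 26 * Real.sqrt 26 = 26 := Real.mul_self_sqrt (by norm_num)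
    calc (1 : ℝ) * Real.sqrt 2 * (Real.sqrt 13 / 2) * (Real.sqrt 26 / 4)
        = (Real.sqrt 2 * Real.sqrt 13) * Real.sqrt 26 / 8 := by ring
      _ = 13 / 4 := by rw [h, h26]; norm_num
  · intro i j hij
    fin_cases i <;> fin_cases j <;> simp_all

/-- **Primes `p ≥ 11` (MINKOWSKI): for `x ∈ O₁₃` with `x/p ∉ O₁₃` there are an integer `m` and `β ∈ O₁₃` with
`0 < nrd((x/p)·m − β) < 1`** — Hardy–Wright Thm. 451 for the lattice `ℤ⁴ + ℤ·X/p` (determinant `13/(4p)` after `B`):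
`32 · 13/4 = 104 < π²·11 ≤ π²p`. [cite: HardyWright2008, §24.2 Theorem 451] [cite: Cassels1997, Ch. III §7.2–7.3] [cite: CardosoMachiavelo2025, Thm. 6 and §5.2 (large primes need no check)] -/
theorem exists_alpha_beta_of_eleven_le {p : ℕ} (hp : p.Prime) (h11 : 11 ≤ p) {x : ℍ[ℚ,-2,-13]} (hx : x ∈ (Submodule.span ℤ (Set.range ![(⟨1, 0, 0, 0⟩ : ℍ[ℚ,-2,-13]), ⟨0, 1, 0, 0⟩, ⟨1/2, 1/2, 1/2, 0⟩, ⟨-1/2, 1/4, 0, 1/4⟩])))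
    (hnot : (p : ℚ)⁻¹ • x ∉ (Submodule.span ℤ (Set.range ![(⟨1, 0, 0, 0⟩ : ℍ[ℚ,-2,-13]), ⟨0, 1, 0, 0⟩, ⟨1/2, 1/2, 1/2, 0⟩, ⟨-1/2, 1/4, 0, 1/4⟩]))) :
    ∃ α ∈ (Submodule.span ℤ (Set.range ![(⟨1, 0, 0, 0⟩ : ℍ[ℚ,-2,-13]), ⟨0, 1, 0, 0⟩, ⟨1/2, 1/2, 1/2, 0⟩, ⟨-1/2, 1/4, 0, 1/4⟩])), ∃ β ∈ (Submodule.span ℤ (Set.range ![(⟨1, 0, 0, 0⟩ : ℍ[ℚ,-2,-13]), ⟨0, 1, 0, 0⟩, ⟨1/2, 1/2, 1/2, 0⟩, ⟨-1/2, 1/4, 0, 1/4⟩])),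
      0 < reducedNorm ℚ ℍ[ℚ,-2,-13] (((p : ℚ)⁻¹ • x) * α - β) ∧ reducedNorm ℚ ℍ[ℚ,-2,-13] (((p : ℚ)⁻¹ • x) * α - β) < 1 := by
  have hp0 : 0 < p := hp.pos
  have hp' : (p : ℚ) ≠ 0 := by exact_mod_cast hp0.ne'
  obtain ⟨X₀, X₁, X₂, X₃, rfl⟩ := (mem_lattice_iff x).1 hx
  -- some coordinate is prime to `p`
  set X : Fin 4 → ℤ := ![X₀, X₁, X₂, X₃] with hX
  have hk : ∃ k, ¬ (p : ℤ) ∣ X k := by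
    by_contra hcon
    push Not at hcon
    obtain ⟨t₀, ht₀⟩ := hcon 0
    obtain ⟨t₁, ht₁⟩ := hcon 1
    obtain ⟨t₂, ht₂⟩ := hcon 2
    obtain ⟨t₃, ht₃⟩ := hcon 3
    simp only [hX, Matrix.cons_val_zero, Matrix.cons_val_one, Matrix.cons_val] at ht₀ ht₁ ht₂ ht₃
    apply hnot
    have e : (p : ℚ)⁻¹ • (⟨(X₀ : ℚ) + (X₂ : ℚ) / 2 - (X₃ : ℚ) / 2, (X₁ : ℚ) + (X₂ : ℚ) / 2 + (X₃ : ℚ) / 4,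
        (X₂ : ℚ) / 2, (X₃ : ℚ) / 4⟩ : ℍ[ℚ,-2,-13]) =
        ⟨(t₀ : ℚ) + (t₂ : ℚ) / 2 - (t₃ : ℚ) / 2, (t₁ : ℚ) + (t₂ : ℚ) / 2 + (t₃ : ℚ) / 4, (t₂ : ℚ) / 2, (t₃ : ℚ) / 4⟩ := by
      rw [inv_smul_eq_iff₀ hp', ht₀, ht₁, ht₂, ht₃]
      ext <;> simp <;> ring
    rw [e]
    exact mk_mem_lattice t₀ t₁ t₂ t₃
  obtain ⟨k, hk⟩ := hk
  -- Minkowski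
  have hB := det_sqrtMatrix
  have hdet : (!![(1 : ℝ), 0, 1/2, -1/2; 0, Real.sqrt 2, Real.sqrt 2 / 2, Real.sqrt 2 / 4; 0, 0, Real.sqrt 13 / 2, 0;
      0, 0, 0, Real.sqrt 26 / 4] : Matrix (Fin 4) (Fin 4) ℝ).det ≠ 0 := by rw [hB]; norm_num
  have hlt : 32 * |(!![(1 : ℝ), 0, 1/2, -1/2; 0, Real.sqrt 2, Real.sqrt 2 / 2, Real.sqrt 2 / 4; 0, 0, Real.sqrt 13 / 2, 0;
      0, 0, 0, Real.sqrt 26 / 4] : Matrix (Fin 4) (Fin 4) ℝ).det| < Real.pi ^ 2 * p := by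
    rw [hB, abs_of_pos (by norm_num)]
    have hπ := Real.pi_gt_d2
    have hp11 : (11 : ℝ) ≤ p := by exact_mod_cast h11
    nlinarith [hπ, hp11, Real.pi_pos]
  obtain ⟨m, β, hw0, hw⟩ := exists_sum_sq_lt_one_of_lt_pi_sq_mul hdet hp hk hlt
  rw [sum_sq_sqrtMatrix_mulVec] at hw
  -- the integer vector `c = pβ + mX` and its form value
  set c₀ := (p : ℤ) * β 0 + m * X₀ with hc₀
  set c₁ := (p : ℤ) * β 1 + m * X₁ with hc₁
  set c₂ := (p : ℤ) * β 2 + m * X₂ with hc₂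
  set c₃ := (p : ℤ) * β 3 + m * X₃ with hc₃
  have hp'' : (p : ℝ) ≠ 0 := by exact_mod_cast hp0.ne'
  have hwc : ∀ i, ((β i : ℝ) + (m : ℝ) / p * X i) = ((![c₀, c₁, c₂, c₃] : Fin 4 → ℤ) i : ℝ) / p := by
    intro i
    fin_cases i <;> simp [hX, hc₀, hc₁, hc₂, hc₃] <;> field_simp
  have hc' : ∀ i, (((![c₀, c₁, c₂, c₃] : Fin 4 → ℤ) i : ℤ) : ℝ) = ((β i : ℝ) + (m : ℝ) / p * X i) * p := fun i =>
    (div_eq_iff hp'').1 (hwc i).symm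
  have e0 := hc' 0
  have e1 := hc' 1
  have e2 := hc' 2
  have e3 := hc' 3
  simp only [Matrix.cons_val_zero, Matrix.cons_val_one, Matrix.cons_val] at e0 e1 e2 e3
  have hQlt : c₀ ^ 2 + 2 * c₁ ^ 2 + 4 * c₂ ^ 2 + 2 * c₃ ^ 2 + c₀ * c₂ - c₀ * c₃ + 2 * c₁ * c₂ + c₁ * c₃ < (p : ℤ) ^ 2 := by
    have hp2 : (0 : ℝ) < (p : ℝ) ^ 2 := by positivity
    have h' : ((c₀ : ℝ) ^ 2 + 2 * c₁ ^ 2 + 4 * c₂ ^ 2 + 2 * c₃ ^ 2 + c₀ * c₂ - c₀ * c₃ + 2 * c₁ * c₂ + c₁ * c₃) < (p : ℝ) ^ 2 := by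
      rw [e0, e1, e2, e3]
      have key := mul_lt_mul_of_pos_right hw hp2
      rw [one_mul] at key
      refine lt_of_eq_of_lt ?_ key
      ring
    exact_mod_cast h'
  have hQpos : 0 < c₀ ^ 2 + 2 * c₁ ^ 2 + 4 * c₂ ^ 2 + 2 * c₃ ^ 2 + c₀ * c₂ - c₀ * c₃ + 2 * c₁ * c₂ + c₁ * c₃ := by
    -- `c ≠ 0` since `w ≠ 0`, and `16·Q₁₃ = 4(2c₀+c₂−c₃)² + 2(4c₁+2c₂+c₃)² + 52c₂² + 26c₃²`
    have hc : ¬ (c₀ = 0 ∧ c₁ = 0 ∧ c₂ = 0 ∧ c₃ = 0) := by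
      rintro ⟨z₀, z₁, z₂, z₃⟩
      apply hw0
      funext i
      rw [hwc i]
      fin_cases i <;> simp [z₀, z₁, z₂, z₃]
    by_contra hle
    push Not at hle
    apply hc
    have h16 : 4 * (2 * c₀ + c₂ - c₃) ^ 2 + 2 * (4 * c₁ + 2 * c₂ + c₃) ^ 2 + 52 * c₂ ^ 2 + 26 * c₃ ^ 2 =
        16 * (c₀ ^ 2 + 2 * c₁ ^ 2 + 4 * c₂ ^ 2 + 2 * c₃ ^ 2 + c₀ * c₂ - c₀ * c₃ + 2 * c₁ * c₂ + c₁ * c₃) := by ring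
    have hP := sq_nonneg (2 * c₀ + c₂ - c₃)
    have hR := sq_nonneg (4 * c₁ + 2 * c₂ + c₃)
    have h2 := sq_nonneg c₂
    have h3 := sq_nonneg c₃
    have z₂ : c₂ = 0 := pow_eq_zero_iff (n := 2) (by norm_num) |>.1 (le_antisymm (by linarith) h2)
    have z₃ : c₃ = 0 := pow_eq_zero_iff (n := 2) (by norm_num) |>.1 (le_antisymm (by linarith) h3)
    have zP : 2 * c₀ + c₂ - c₃ = 0 := pow_eq_zero_iff (n := 2) (by norm_num) |>.1 (le_antisymm (by linarith) hP)
    have zR : 4 * c₁ + 2 * c₂ + c₃ = 0 := pow_eq_zero_iff (n := 2) (by norm_num) |>.1 (le_antisymm (by linarith) hR)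
    refine ⟨?_, ?_, z₂, z₃⟩ <;> omega
  -- the multiplier `α = m ∈ ℤ ⊂ O₁₃`
  refine ⟨_, mk_mem_lattice m 0 0 0, exists_beta hp0 (mk_mem_lattice m 0 0 0) (mk_mul_intCast X₀ X₁ X₂ X₃ m) ?_ ?_ ?_ ?_
    hQpos hQlt⟩
  · exact Int.ModEq.symm (Int.modEq_iff_dvd.2 ⟨β 0, by rw [hc₀]; ring⟩)
  · exact Int.ModEq.symm (Int.modEq_iff_dvd.2 ⟨β 1, by rw [hc₁]; ring⟩)
  · exact Int.ModEq.symm (Int.modEq_iff_dvd.2 ⟨β 2, by rw [hc₂]; ring⟩)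
  · exact Int.ModEq.symm (Int.modEq_iff_dvd.2 ⟨β 3, by rw [hc₃]; ring⟩)

end LargePrimes

/-! ## §4 All primes; the criterion -/

section Criterion

/-- All primes: `δ ∈ O₁₃`, `δ/p ∉ O₁₃` ⟹ `∃ γ, β ∈ O₁₃` with `0 < nrd((δ/p)γ − β) < 1` (certificates for `p ≤ 7`, Minkowski for
`p ≥ 11`; there is no prime in between). [cite: CardosoMachiavelo2025, Thm. 4, Thm. 6 and §5.2 Thm. 9] [cite: HardyWright2008, §24.2 Thm. 451] -/
theorem exists_alpha_beta_of_prime {p : ℕ} (hp : p.Prime) {x : ℍ[ℚ,-2,-13]} (hx : x ∈ (Submodule.span ℤ (Set.range ![(⟨1, 0, 0, 0⟩ : ℍ[ℚ,-2,-13]), ⟨0, 1, 0, 0⟩, ⟨1/2, 1/2, 1/2, 0⟩, ⟨-1/2, 1/4, 0, 1/4⟩]))) (hnot : (p : ℚ)⁻¹ • x ∉ (Submodule.span ℤ (Set.range ![(⟨1, 0, 0, 0⟩ : ℍ[ℚ,-2,-13]), ⟨0, 1, 0, 0⟩, ⟨1/2, 1/2, 1/2, 0⟩, ⟨-1/2,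 1/4, 0, 1/4⟩]))) :
    ∃ γ ∈ (Submodule.span ℤ (Set.range ![(⟨1, 0, 0, 0⟩ : ℍ[ℚ,-2,-13]), ⟨0, 1, 0, 0⟩, ⟨1/2, 1/2, 1/2, 0⟩, ⟨-1/2, 1/4, 0, 1/4⟩])), ∃ β ∈ (Submodule.span ℤ (Set.range ![(⟨1, 0, 0, 0⟩ : ℍ[ℚ,-2,-13]), ⟨0, 1, 0, 0⟩, ⟨1/2, 1/2, 1/2, 0⟩, ⟨-1/2, 1/4, 0, 1/4⟩])),
      0 < reducedNorm ℚ ℍ[ℚ,-2,-13] (((p : ℚ)⁻¹ • x) * γ - β) ∧ reducedNorm ℚ ℍ[ℚ,-2,-13] (((p : ℚ)⁻¹ • x) * γ - β) < 1 := by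
  by_cases hle : p ≤ 7
  · exact exists_alpha_beta_of_prime_le hp hle hx hnot
  · by_cases h11 : 11 ≤ p
    · exact exists_alpha_beta_of_eleven_le hp h11 hx hnot
    · exfalso
      interval_cases p <;> exact absurd hp (by decide)

/-- **THE DEDEKIND–HASSE CRITERION HOLDS FOR `O₁₃`** (Cardoso–Machiavelo Thm. 3 ∕ Thm. 9, right-multiplier form): for every
`ρ ∈ (−2,−13 ∣ ℚ)` not in `O₁₃` there are `γ, β ∈ O₁₃` with `0 < nrd(ργ − β) < 1`. (Reduction: let `n ≥ 2` be the least positive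
integer with `nρ ∈ O₁₃`, `p` a prime factor, `m = n/p`; then `δ := nρ ∈ O₁₃`, `δ/p = mρ ∉ O₁₃`, and multipliers `γ, β` for `δ/p`
give `mγ, β` for `ρ`.) [cite: CardosoMachiavelo2025, Thm. 3, Thm. 4 and Thm. 9] -/
theorem dedekindHasse {ρ : ℍ[ℚ,-2,-13]} (hρ : ρ ∉ (Submodule.span ℤ (Set.range ![(⟨1, 0, 0, 0⟩ : ℍ[ℚ,-2,-13]), ⟨0, 1, 0, 0⟩, ⟨1/2, 1/2, 1/2, 0⟩, ⟨-1/2, 1/4, 0, 1/4⟩]))) :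
    ∃ γ ∈ (Submodule.span ℤ (Set.range ![(⟨1, 0, 0, 0⟩ : ℍ[ℚ,-2,-13]), ⟨0, 1, 0, 0⟩, ⟨1/2, 1/2, 1/2, 0⟩, ⟨-1/2, 1/4, 0, 1/4⟩])), ∃ β ∈ (Submodule.span ℤ (Set.range ![(⟨1, 0, 0, 0⟩ : ℍ[ℚ,-2,-13]), ⟨0, 1, 0, 0⟩, ⟨1/2, 1/2, 1/2, 0⟩, ⟨-1/2, 1/4, 0, 1/4⟩])), 0 < reducedNorm ℚ ℍ[ℚ,-2,-13] (ρ * γ - β) ∧ reducedNorm ℚ ℍ[ℚ,-2,-13] (ρ * γ - β) < 1 := by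
  classical
  have hex : ∃ n : ℕ, 0 < n ∧ (n : ℚ) • ρ ∈ (Submodule.span ℤ (Set.range ![(⟨1, 0, 0, 0⟩ : ℍ[ℚ,-2,-13]), ⟨0, 1, 0, 0⟩, ⟨1/2, 1/2, 1/2, 0⟩, ⟨-1/2, 1/4, 0, 1/4⟩])) := by
    obtain ⟨N, hN0, hN⟩ := isFullLattice_lattice.2 ρ
    refine ⟨N.natAbs, Int.natAbs_pos.2 hN0, ?_⟩
    have e : ((N.natAbs : ℕ) : ℚ) • ρ = (N.natAbs : ℤ) • ρ := by
      rw [← Int.cast_smul_eq_zsmul ℚ, Int.cast_natCast]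
    rw [e]
    rcases Int.natAbs_eq N with h | h
    · rw [← h]; exact hN
    · have h' : (N.natAbs : ℤ) = -N := by omega
      rw [h', neg_smul]; exact ((Submodule.span ℤ (Set.range ![(⟨1, 0, 0, 0⟩ : ℍ[ℚ,-2,-13]), ⟨0, 1, 0, 0⟩, ⟨1/2, 1/2, 1/2, 0⟩, ⟨-1/2, 1/4, 0, 1/4⟩]))).neg_mem hN
  let n := Nat.find hex
  obtain ⟨hn0, hn⟩ : 0 < n ∧ (n : ℚ) • ρ ∈ (Submodule.span ℤ (Set.range ![(⟨1, 0, 0, 0⟩ : ℍ[ℚ,-2,-13]), ⟨0, 1, 0, 0⟩, ⟨1/2, 1/2, 1/2, 0⟩, ⟨-1/2, 1/4, 0, 1/4⟩])) := Nat.find_spec hex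
  have hmin : ∀ m : ℕ, 0 < m → (m : ℚ) • ρ ∈ (Submodule.span ℤ (Set.range ![(⟨1, 0, 0, 0⟩ : ℍ[ℚ,-2,-13]), ⟨0, 1, 0, 0⟩, ⟨1/2, 1/2, 1/2, 0⟩, ⟨-1/2, 1/4, 0, 1/4⟩])) → n ≤ m := fun m hm hmρ => Nat.find_min' hex ⟨hm, hmρ⟩
  have hn1 : n ≠ 1 := by
    intro h
    rw [h, Nat.cast_one, one_smul] at hn
    exact hρ hn
  let p := n.minFac
  have hp : p.Prime := Nat.minFac_prime hn1
  obtain ⟨m, hm⟩ : p ∣ n := Nat.minFac_dvd n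
  have hm0 : 0 < m := Nat.pos_of_ne_zero (by rintro rfl; rw [mul_zero] at hm; omega)
  have hmn : m < n := by
    rw [hm]
    exact lt_mul_of_one_lt_left hm0 hp.one_lt
  have hmρ : (m : ℚ) • ρ ∉ (Submodule.span ℤ (Set.range ![(⟨1, 0, 0, 0⟩ : ℍ[ℚ,-2,-13]), ⟨0, 1, 0, 0⟩, ⟨1/2, 1/2, 1/2, 0⟩, ⟨-1/2, 1/4, 0, 1/4⟩])) := fun h => absurd (hmin m hm0 h) (not_le.2 hmn)
  have hδ : (p : ℚ)⁻¹ • ((n : ℚ) • ρ) = (m : ℚ) • ρ := by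
    rw [smul_smul, hm, Nat.cast_mul, ← mul_assoc, inv_mul_cancel₀ (by exact_mod_cast hp.ne_zero), one_mul]
  have hnot : (p : ℚ)⁻¹ • ((n : ℚ) • ρ) ∉ (Submodule.span ℤ (Set.range ![(⟨1, 0, 0, 0⟩ : ℍ[ℚ,-2,-13]), ⟨0, 1, 0, 0⟩, ⟨1/2, 1/2, 1/2, 0⟩, ⟨-1/2, 1/4, 0, 1/4⟩])) := by rw [hδ]; exact hmρ
  obtain ⟨γ, hγ, β, hβ, h1, h2⟩ := exists_alpha_beta_of_prime hp hn hnot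
  refine ⟨(m : ℚ) • γ, ?_, β, hβ, ?_⟩
  · rw [Nat.cast_smul_eq_nsmul]
    exact ((Submodule.span ℤ (Set.range ![(⟨1, 0, 0, 0⟩ : ℍ[ℚ,-2,-13]), ⟨0, 1, 0, 0⟩, ⟨1/2, 1/2, 1/2, 0⟩, ⟨-1/2, 1/4, 0, 1/4⟩]))).nsmul_mem hγ m
  · have e : ρ * ((m : ℚ) • γ) - β = ((p : ℚ)⁻¹ • ((n : ℚ) • ρ)) * γ - β := by
      rw [hδ, mul_smul_comm, smul_mul_assoc]
    rw [e]
    exact ⟨h1, h2⟩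

end Criterion

end Literature.NumberTheory.Automorphic.MaxOrderDiscThirteen
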